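import Literature.Analysis.FunctionSpaces.TorusAnalyticComposition
import Literature.Analysis.FunctionSpaces.TorusFourierSynthesis
import Literature.Analysis.FunctionSpaces.TorusScalarFourierSeries
import Literature.Analysis.FunctionSpaces.PeriodicLogCostDeriv
import Literature.Analysis.FunctionSpaces.TorusSpaceTime
import Literature.Analysis.FunctionSpaces.TorusCalculusProofs
import Mathlib.Analysis.SpecialFunctions.Complex.LogBounds
import Mathlib.Analysis.SpecialFunctions.Complex.Arg
import Mathlib.Analysis.SpecificLimits.Normed
import HarnessLib

/-!
# Refutation of the vendored fact `Torus.ArmstrongVicol2025_transportShift` (Armstrong–Vicol, App. A Lemma 7.7 AS PRINTED)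

Analysis/FunctionSpaces proof file (theorems, with the private-purpose definitions of one explicit
witness; no named facts). The named fact `Torus.ArmstrongVicol2025_transportShift d` of
`TorusAnalyticComposition` transcribes Lemma 7.7 of S. Armstrong, V. Vicol, *Anomalous diffusion by fractal
homogenization*, Ann. PDE 11 (2025) = arXiv:2305.05048, App. A (§7.2 of the arXiv version, p. 72,
(e.transport), (e.bear.salmon.1)–(e.bear.salmon.2)) VERBATIM, with the printed radius
`R_Y(t) = R_g + 4|t| d C_f R_f²`. Its docstring carries an ERRATUM: the statement is false in the regime
`R_g ≫ R_f`, the corrected radius being `R_g(1 + 4|t| d C_f R_f)`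
(THEOREM `Torus.dnorm_transportShift_le` of `TorusAnalyticTransport`, from which Cor. 7.8 is discharged). This
file settles the erratum in the kernel:

  `not_ArmstrongVicol2025_transportShift : ¬ ArmstrongVicol2025_transportShift (Fin 1)`.

## The witness (`d = 1`, `θ = 2πy₀`)

* drift `f = -(a/2π) sin θ · e₀` with `a = π`, `C_f = 1`, `R_f = 4π` (so the printed time is
  `T = 1/(4 d C_f R_f) = 1/(16π)` and `aT = 1/16`); `⟦f⟧_{n,4π} = (n+1)²/(2ⁿ⁺¹ n!) ≤ 1` for all `n`
  (`dnorm_fvec_le`);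
* source `g = g_μ · e₀`, `g_ν = (1 + cos θ)/D_ν`, `D_ν = (1 + ν²) + (1 - ν²) cos θ = ((ν+1)²/2)|1 - r_ν e^{iθ}|²`,
  `r_ν = (ν-1)/(ν+1)` — a Poisson-kernel profile with Fourier coefficients `ĝ_ν(0) = 1/(ν+1)`,
  `ĝ_ν(±m) = ν r_ν^{m-1}/(ν+1)²` (`hasSum_gsc`, geometric series); with `μ = 10⁴`, `R_g = π(μ+1)`,
  `⟦g_μ⟧_{n,R_g} ≤ (n+1)² ≤ (N+1)² =: C_g` for `1 ≤ n ≤ N = 128` (`dnorm_gvec_le`, from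
  `‖∂ⁿφ‖_∞ ≤ ∑_k (2π|k|)ⁿ |φ̂(k)|` and `∑_{m≥1} mⁿ r^{m-1} ≤ n!/(1-r)^{n+1}`);
* the family `g_ν` is invariant under the flow of `f` (`f ∂_θ g_ν = -a ν ∂_ν g_ν`), so the solution of
  `∂ₜY + f·∇Y = g_μ`, `Y(0) = 0` is explicit: `Y(t) = ∫₀ᵗ g_{μe^{as}} ds = t - (1/2a)(log D_{μe^{at}} - log D_μ)`
  (`hasDerivAt_Yvec`: the transport equation is the algebraic identity `g_ν - ½ sin²θ (1-ν²)/D_ν = (1+cos θ)/2`);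
  its Fourier coefficients at time `T` are `Ŷ(±m) = (r_{ν(T)}^m - r_μ^m)/(2am) ≥ 0`, `ν(T) = μe^{aT}`
  (`hasSum_ysc`, the logarithmic series `∑ zⁿ/n = -log(1-z)`).

## The contradiction

The fact at `N = 128`, `t = T`, `i = 0` asserts `⟦Y(T)⟧_{128, R_g + 4TC_fR_f²} ≤ 8 C_g T` with
`R_g + 4T C_f R_f² = π(μ+5)`, whence `|∂¹²⁸Y(T)(0)| ≤ 8C_gT · 128! (π(μ+5))¹²⁸/(129)² = 128! π¹²⁷ (μ+5)¹²⁸/2`.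
But `∂¹²⁸Y(T)(0) = ∑_k (2πk)¹²⁸ Ŷ(k)` (pointwise Fourier expansion of a derivative of a smooth function,
`hasSum_iterPartialDeriv_replicate`; `i¹²⁸ = 1`, all terms `≥ 0`), which is at least its `m ≥ 1` part
`((2π)¹²⁸/2a) ∑_{m≥1} m¹²⁷ (r₁^m - r₀^m) ≥ ((2π)¹²⁸/2a) · 127! · ((r₁/(1-r₁))¹²⁸ - (r₀/(1-r₀))¹²⁸)`
(`m¹²⁷ ≥ 127!·C(m-1,127)` and the negative-binomial series), `= π¹²⁷ · 127! · ((ν(T)-1)¹²⁸ - (μ-1)¹²⁸)/2`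
since `r/(1-r) = (ν-1)/2`. With `ν(T) - 1 = 10⁴e^{1/16} - 1 ≥ 10624` this contradicts
`10624¹²⁸ - 9999¹²⁸ > 128 · 10005¹²⁸` (`numeric_key`): the transport by `f` amplifies order-`N` seminorms by
`e^{NaT} = e^{N/16}` at essentially unchanged radius when `R_g ≫ R_f`, which the printed radius does not absorb.

## Contents

* §A/§B scalar tools: geometric and logarithmic series on the unit circle in closed real form
  (`poisson_closed_form`, `log_add_log_conj`); powers versus binomials and the negative-binomial sums
  (`tsum_succ_pow_mul_pow_le`, `factorial_mul_sub_le_tsum`).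
* §C the witness: definitions `e0`, `Dfun`, `gsc`, `fsc`, `nuAt`, `ysc`, `fvec`, `gvec`, `Yvec`; smoothness,
  joint smoothness, `Y(0) = 0`, the transport equation `hasDerivAt_Yvec`.
* §D/§E/§F general tools (any complete complex `V`, any `d`): `hasSum_iterPartialDeriv_replicate`
  (`∂ⱼⁿG(y) = ∑_k e_k(y)(2πikⱼ)ⁿĜ(k)`), `norm_iterPartialDeriv_replicate_le_tsum`
  (`‖∂ⱼⁿG‖_∞ ≤ ∑_k (2π|kⱼ|)ⁿ‖Ĝ(k)‖`, converse companion of `TorusAnalyticFourierDecay`), and the real/vector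
  bridges on `T¹`.
* §G the drift hypothesis; §H geometric families decay rapidly on `ℤ¹`; §I the source: Fourier series,
  coefficients, hypothesis; §J the solution: Fourier series, coefficients; §K the lower bound; §L the theorem.

## References

* S. Armstrong, V. Vicol, Ann. PDE 11 (2025), arXiv:2305.05048, App. A Lemma 7.7 (arXiv §7.2 p. 72).
  [`ArmstrongVicol2025`]
* L. Grafakos, *Classical Fourier Analysis*, 3rd ed., GTM 249 (2014), Prop. 3.1.2 (10), Prop. 3.2.5, §3.3.3
  (derivatives and absolutely convergent Fourier series). [`Grafakos2014`]

## Mathlib / tree search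

Tree: `Torus.IsSmooth.fourierSynth_mFourierCoeff`, `Torus.RapidDecay.hasSum_fourierSynth`,
`Torus.RapidDecay.mFourierCoeff_fourierSynth`, `Torus.mFourierCoeff_partialDeriv_iterate`,
`Torus.norm_iterPartialDeriv_le_of_dnorm_le`, `Torus.dnorm_le_of_forall_norm_iterPartialDeriv_le`,
`Torus.partialDeriv_cosCoord` / `partialDeriv_sinCoord`, `Torus.IsSmooth.hasDerivAt_line_zero`,
`Torus.partialDeriv_clm_comp`, `Torus.fderiv_apply_eq_sum_partialDeriv`, `Torus.isSmoothSpaceTimeOn_const`.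
Mathlib: `Complex.hasSum_taylorSeries_neg_log`, `hasSum_geometric_of_norm_lt_one`,
`hasSum_choose_mul_geometric_of_norm_lt_one`, `HasSum.of_add_one_of_neg_add_one`, `hasSum_le_inj`,
`Complex.hasSum_re`, `fourier_coe_apply` / `fourier_add` / `fourier_neg`.
-/

noncomputable section

open Complex Finset Filter Topology UnitAddTorus
open scoped ComplexConjugate ContDiff

namespace Literature.Analysis.FunctionSpaces

namespace Torus

namespace TransportShiftRefutation


/-- Transport of a `HasSum` along pointwise equal terms and equal sums. [folklore] -/
private theorem hasSum_of_hasSum_eq {ι M : Type*} [AddCommMonoid M] [TopologicalSpace M] {f g : ι → M}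
    {a b : M} (h : HasSum f a) (hfg : ∀ i, f i = g i) (hab : a = b) : HasSum g b := by
  have hf : f = g := funext hfg
  subst hf; subst hab; exact h

/-! ## §B Powers versus binomial coefficients; negative-binomial sums -/

/-- `(p+1)ⁿ ≤ n! · C(p+n, n)` (a power is at most the rising factorial). [folklore] -/
private theorem succ_pow_le_factorial_mul_choose (p : ℕ) :
    ∀ n : ℕ, (((p + 1 : ℕ) : ℝ)) ^ n ≤ (n.factorial : ℝ) * ((p + n).choose n : ℝ)
  | 0 => by simp
  | n + 1 => by
    have ih := succ_pow_le_factorial_mul_choose p n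
    have h := Nat.add_one_mul_choose_eq (p + n) n
    -- `(p+n+1) * C(p+n, n) = C(p+n+1, n+1) * (n+1)`
    have h' : ((p + n + 1 : ℕ) : ℝ) * ((p + n).choose n : ℝ) =
        (((p + n + 1).choose (n + 1) : ℕ) : ℝ) * ((n + 1 : ℕ) : ℝ) := by
      exact_mod_cast h
    have key : ((n + 1).factorial : ℝ) * ((p + (n + 1)).choose (n + 1) : ℝ) =
        ((p + n + 1 : ℕ) : ℝ) * ((n.factorial : ℝ) * ((p + n).choose n : ℝ)) := by
      rw [show p + (n + 1) = p + n + 1 by ring, Nat.factorial_succ]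
      push_cast at h' ⊢
      linear_combination (-(n.factorial : ℝ)) * h'
    rw [key, pow_succ, mul_comm (((p + 1 : ℕ) : ℝ) ^ n)]
    have hpn : ((p + 1 : ℕ) : ℝ) ≤ ((p + n + 1 : ℕ) : ℝ) := by exact_mod_cast (by omega)
    exact mul_le_mul hpn ih (by positivity) (by positivity)

/-- `n! · C(p, n) ≤ (p+1)ⁿ` (the falling factorial is at most a power). [folklore] -/
private theorem factorial_mul_choose_le_succ_pow (p n : ℕ) :
    (n.factorial : ℝ) * (p.choose n : ℝ) ≤ (((p + 1 : ℕ) : ℝ)) ^ n := by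
  have h1 : n.factorial * p.choose n ≤ (p + 1) ^ n := by
    rw [← Nat.descFactorial_eq_factorial_mul_choose]
    exact (Nat.descFactorial_le_pow p n).trans (Nat.pow_le_pow_left (Nat.le_succ p) n)
  exact_mod_cast h1

/-- `(n+1)² ≤ 2ⁿ⁺¹ · n!`. [folklore] -/
private theorem succ_sq_le_two_pow_mul_factorial (n : ℕ) : ((n : ℝ) + 1) ^ 2 ≤ 2 ^ (n + 1) * (n.factorial : ℝ) := by
  have key : ∀ m : ℕ, (m + 1) ^ 2 ≤ 2 ^ (m + 1) * m.factorial := by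
    intro m
    induction m with
    | zero => simp
    | succ m ih =>
      rcases Nat.lt_or_ge m 1 with hm | hm
      · interval_cases m; simp [Nat.factorial]
      · have h1 : 2 ^ (m + 1 + 1) * (m + 1).factorial = 2 * (m + 1) * (2 ^ (m + 1) * m.factorial) := by
          rw [Nat.factorial_succ]; ring
        rw [h1]
        nlinarith [Nat.mul_le_mul_left (2 * (m + 1)) ih, hm]
  exact_mod_cast key n

variable {r r₀ r₁ : ℝ}

/-- The negative-binomial series `∑ⱼ C(j+n, n) rʲ = (1 - r)^{-(n+1)}` for `0 ≤ r < 1`. [folklore] -/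
private theorem hasSum_choose_mul_pow (n : ℕ) (hr0 : 0 ≤ r) (hr1 : r < 1) :
    HasSum (fun j : ℕ => ((j + n).choose n : ℝ) * r ^ j) (1 / (1 - r) ^ (n + 1)) := by
  have hr : ‖r‖ < 1 := by rw [Real.norm_eq_abs, abs_of_nonneg hr0]; exact hr1
  exact hasSum_choose_mul_geometric_of_norm_lt_one n hr

/-- Shifted negative-binomial series: `∑ₚ C(p, n) r^{p+1} = r^{n+1}/(1-r)^{n+1}` (`0 ≤ r < 1`).
[folklore] -/
private theorem hasSum_choose_mul_pow_succ (n : ℕ) (hr0 : 0 ≤ r) (hr1 : r < 1) :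
    HasSum (fun p : ℕ => (p.choose n : ℝ) * r ^ (p + 1)) (r ^ (n + 1) / (1 - r) ^ (n + 1)) := by
  have h := (hasSum_choose_mul_pow n hr0 hr1).mul_left (r ^ (n + 1))
  have h2 : HasSum (fun j : ℕ => (fun p : ℕ => (p.choose n : ℝ) * r ^ (p + 1)) (j + n))
      (r ^ (n + 1) / (1 - r) ^ (n + 1)) := by
    refine hasSum_of_hasSum_eq h (fun j => ?_) (by rw [mul_one_div])
    simp only
    rw [show j + n + 1 = (n + 1) + j by ring, pow_add]
    ring
  have hzero : ∑ i ∈ Finset.range n, (fun p : ℕ => (p.choose n : ℝ) * r ^ (p + 1)) i = 0 := by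
    refine Finset.sum_eq_zero (fun p hp => ?_)
    rw [Finset.mem_range] at hp
    simp [Nat.choose_eq_zero_of_lt hp]
  have h2' : HasSum (fun j : ℕ => (fun p : ℕ => (p.choose n : ℝ) * r ^ (p + 1)) (j + n))
      (r ^ (n + 1) / (1 - r) ^ (n + 1) - ∑ i ∈ Finset.range n, (fun p : ℕ => (p.choose n : ℝ) * r ^ (p + 1)) i) := by
    rw [hzero, sub_zero]; exact h2
  exact (hasSum_nat_add_iff' n).1 h2'

/-- Summability of `(p+1)ⁿ rᵖ` for `0 ≤ r < 1`. [folklore] -/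
private theorem summable_succ_pow_mul_pow (n : ℕ) (hr0 : 0 ≤ r) (hr1 : r < 1) :
    Summable (fun p : ℕ => (((p + 1 : ℕ) : ℝ)) ^ n * r ^ p) := by
  refine Summable.of_nonneg_of_le (fun p => by positivity)
    (fun p => mul_le_mul_of_nonneg_right (succ_pow_le_factorial_mul_choose p n) (pow_nonneg hr0 p))
    ?_
  have := (hasSum_choose_mul_pow n hr0 hr1).summable.mul_left (n.factorial : ℝ)
  simpa [mul_assoc] using this

/-- **Upper negative-binomial bound** `∑ₚ (p+1)ⁿ rᵖ ≤ n!/(1-r)^{n+1}` (`0 ≤ r < 1`). [folklore] -/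
private theorem tsum_succ_pow_mul_pow_le (n : ℕ) (hr0 : 0 ≤ r) (hr1 : r < 1) :
    ∑' p : ℕ, (((p + 1 : ℕ) : ℝ)) ^ n * r ^ p ≤ (n.factorial : ℝ) / (1 - r) ^ (n + 1) := by
  have hmaj : HasSum (fun p : ℕ => (n.factorial : ℝ) * ((p + n).choose n : ℝ) * r ^ p)
      ((n.factorial : ℝ) / (1 - r) ^ (n + 1)) := by
    exact hasSum_of_hasSum_eq ((hasSum_choose_mul_pow n hr0 hr1).mul_left (n.factorial : ℝ))
      (fun p => by ring) (by rw [mul_one_div])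
  refine hasSum_le (fun p => ?_) (summable_succ_pow_mul_pow n hr0 hr1).hasSum hmaj
  exact mul_le_mul_of_nonneg_right (succ_pow_le_factorial_mul_choose p n) (pow_nonneg hr0 p)

/-- Summability of `(p+1)ⁿ (r₁^{p+1} - r₀^{p+1})`. [folklore] -/
private theorem summable_succ_pow_mul_pow_sub (n : ℕ) (h0 : 0 ≤ r₀) (h01 : r₀ ≤ r₁) (h1 : r₁ < 1) :
    Summable (fun p : ℕ => (((p + 1 : ℕ) : ℝ)) ^ n * (r₁ ^ (p + 1) - r₀ ^ (p + 1))) := by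
  have hs₁ := (summable_succ_pow_mul_pow n (h0.trans h01) h1).mul_left r₁
  have hs₀ := (summable_succ_pow_mul_pow n h0 (h01.trans_lt h1)).mul_left r₀
  refine (hs₁.sub hs₀).congr (fun p => ?_)
  simp only [pow_succ]
  ring

/-- **Lower negative-binomial bound for a difference**:
`n! (r₁^{n+1}/(1-r₁)^{n+1} - r₀^{n+1}/(1-r₀)^{n+1}) ≤ ∑ₚ (p+1)ⁿ (r₁^{p+1} - r₀^{p+1})`
for `0 ≤ r₀ ≤ r₁ < 1`. [folklore] -/
private theorem factorial_mul_sub_le_tsum (n : ℕ) (h0 : 0 ≤ r₀) (h01 : r₀ ≤ r₁) (h1 : r₁ < 1) :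
    (n.factorial : ℝ) * (r₁ ^ (n + 1) / (1 - r₁) ^ (n + 1) - r₀ ^ (n + 1) / (1 - r₀) ^ (n + 1)) ≤
      ∑' p : ℕ, (((p + 1 : ℕ) : ℝ)) ^ n * (r₁ ^ (p + 1) - r₀ ^ (p + 1)) := by
  have hmin : HasSum (fun p : ℕ => (n.factorial : ℝ) * (p.choose n : ℝ) * (r₁ ^ (p + 1) - r₀ ^ (p + 1)))
      ((n.factorial : ℝ) * (r₁ ^ (n + 1) / (1 - r₁) ^ (n + 1) - r₀ ^ (n + 1) / (1 - r₀) ^ (n + 1))) := by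
    exact hasSum_of_hasSum_eq (((hasSum_choose_mul_pow_succ n (h0.trans h01) h1).sub
      (hasSum_choose_mul_pow_succ n h0 (h01.trans_lt h1))).mul_left (n.factorial : ℝ))
      (fun p => by ring) rfl
  refine hasSum_le (fun p => ?_) hmin (summable_succ_pow_mul_pow_sub n h0 h01 h1).hasSum
  have hdiff : 0 ≤ r₁ ^ (p + 1) - r₀ ^ (p + 1) := sub_nonneg.2 (pow_le_pow_left₀ h0 h01 _)
  exact mul_le_mul_of_nonneg_right (factorial_mul_choose_le_succ_pow p n) hdiff

/-! ## §A Two classical Fourier series on the unit circle -/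

variable {z : ℂ}

/-- `∑ₙ rⁿ z^{n+1} = z/(1 - r z)` for `|r| < 1`, `‖z‖ = 1`. [folklore] -/
private theorem hasSum_pow_mul_pow_succ (hr : |r| < 1) (hz : ‖z‖ = 1) :
    HasSum (fun n : ℕ => ((r : ℂ) ^ n) * z ^ (n + 1)) (z / (1 - r * z)) := by
  have hrz : ‖(r : ℂ) * z‖ < 1 := by
    rw [norm_mul, Complex.norm_real, hz, mul_one, Real.norm_eq_abs]; exact hr
  exact hasSum_of_hasSum_eq ((hasSum_geometric_of_norm_lt_one hrz).mul_left z)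
    (fun n => by rw [mul_pow, pow_succ]; ring) (by rw [div_eq_mul_inv])

/-- `normSq (1 - r z) = 1 - 2 r Re z + r²` for `‖z‖ = 1`. [folklore] -/
private theorem normSq_one_sub_mul (r : ℝ) (hz : ‖z‖ = 1) :
    Complex.normSq (1 - r * z) = 1 - 2 * r * z.re + r ^ 2 := by
  have hzz : z.re * z.re + z.im * z.im = 1 := by
    have := Complex.normSq_apply z
    rw [← Complex.sq_norm, hz] at this
    linarith
  rw [Complex.normSq_apply]
  simp only [Complex.sub_re, Complex.one_re, Complex.mul_re, Complex.ofReal_re, Complex.ofReal_im,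
    zero_mul, sub_zero, Complex.sub_im, Complex.one_im, Complex.mul_im, add_zero, zero_sub]
  nlinarith [hzz]

/-- `1 - 2 r c + r² > 0` for `|r| < 1`, `|c| ≤ 1`. [folklore] -/
private theorem one_sub_two_mul_add_sq_pos {c : ℝ} (hr : |r| < 1) (hc : |c| ≤ 1) : 0 < 1 - 2 * r * c + r ^ 2 := by
  have h1 : |r * c| < 1 := by
    rw [abs_mul]
    calc |r| * |c| ≤ |r| * 1 := mul_le_mul_of_nonneg_left hc (abs_nonneg r)
      _ < 1 := by rw [mul_one]; exact hr
  have h2 := (abs_lt.1 h1)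
  nlinarith [sq_nonneg (r - c), sq_abs c, abs_le.1 hc, sq_nonneg r]

/-- `Re (z/(1 - r z)) = (Re z - r)/(1 - 2 r Re z + r²)` for `‖z‖ = 1`, `|r| < 1`. [folklore] -/
private theorem re_div_one_sub_mul (hr : |r| < 1) (hz : ‖z‖ = 1) :
    (z / (1 - r * z)).re = (z.re - r) / (1 - 2 * r * z.re + r ^ 2) := by
  have hzz : z.re * z.re + z.im * z.im = 1 := by
    have := Complex.normSq_apply z
    rw [← Complex.sq_norm, hz] at this
    linarith
  have hn := normSq_one_sub_mul r hz
  have hpos : 0 < 1 - 2 * r * z.re + r ^ 2 := by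
    refine one_sub_two_mul_add_sq_pos hr ?_
    have := Complex.abs_re_le_norm z
    rwa [hz] at this
  have hw_re : (1 - (r : ℂ) * z).re = 1 - r * z.re := by simp
  have hw_im : (1 - (r : ℂ) * z).im = -(r * z.im) := by simp
  rw [Complex.div_re, hn, hw_re, hw_im, ← add_div, div_left_inj' hpos.ne']
  linear_combination (-r) * hzz

/-- `z/(1-rz) + conj z/(1 - r conj z) = 2 (Re z - r)/(1 - 2 r Re z + r²)` (real), for `‖z‖ = 1`,
`|r| < 1`. [folklore] -/
private theorem div_add_conj_div (hr : |r| < 1) (hz : ‖z‖ = 1) :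
    z / (1 - r * z) + conj z / (1 - r * conj z) =
      ((2 * (z.re - r) / (1 - 2 * r * z.re + r ^ 2) : ℝ) : ℂ) := by
  have hconj : conj z / (1 - r * conj z) = conj (z / (1 - r * z)) := by
    rw [map_div₀, map_sub, map_one, map_mul, Complex.conj_ofReal]
  rw [hconj, Complex.add_conj, re_div_one_sub_mul hr hz]
  push_cast
  ring

/-- **The Poisson-type series**: for `ν > 0`, `r = (ν-1)/(ν+1)`, `‖z‖ = 1`, `c = Re z`,
`1/(ν+1) + (ν/(ν+1)²)(z/(1-rz) + z̄/(1-r z̄)) = (1 + c)/((1+ν²) + (1-ν²) c)`. [folklore] -/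
private theorem poisson_closed_form {ν : ℝ} (hν : 0 < ν) (hz : ‖z‖ = 1)
    (hD : (1 + ν ^ 2) + (1 - ν ^ 2) * z.re ≠ 0) :
    (1 / (ν + 1) : ℂ) + (ν / (ν + 1) ^ 2 : ℂ) *
        (z / (1 - ((ν - 1) / (ν + 1) : ℝ) * z) + conj z / (1 - ((ν - 1) / (ν + 1) : ℝ) * conj z)) =
      (((1 + z.re) / ((1 + ν ^ 2) + (1 - ν ^ 2) * z.re) : ℝ) : ℂ) := by
  set r : ℝ := (ν - 1) / (ν + 1) with hr_def
  have hν1 : 0 < ν + 1 := by linarith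
  have hr : |r| < 1 := by
    rw [hr_def, abs_div, abs_of_pos hν1, div_lt_one hν1]
    exact abs_sub_lt_iff.2 ⟨by linarith, by linarith⟩
  have hc : |z.re| ≤ 1 := by have := Complex.abs_re_le_norm z; rwa [hz] at this
  have hq : 0 < 1 - 2 * r * z.re + r ^ 2 := one_sub_two_mul_add_sq_pos hr hc
  rw [div_add_conj_div hr hz]
  have e1 : (1 / (ν + 1) : ℂ) = ((1 / (ν + 1) : ℝ) : ℂ) := by push_cast; rfl
  have e2 : (ν / (ν + 1) ^ 2 : ℂ) = ((ν / (ν + 1) ^ 2 : ℝ) : ℂ) := by push_cast; rfl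
  rw [e1, e2, ← Complex.ofReal_mul, ← Complex.ofReal_add]
  congr 1
  -- the real identity
  set c : ℝ := z.re with hc_def
  set D : ℝ := (1 + ν ^ 2) + (1 - ν ^ 2) * c with hD_def
  have hν1' : ν + 1 ≠ 0 := hν1.ne'
  have hq' : 1 - 2 * r * c + r ^ 2 = 2 * D / (ν + 1) ^ 2 := by
    rw [hr_def, hD_def]; field_simp; ring
  have hqne : 1 - 2 * r * c + r ^ 2 ≠ 0 := hq.ne'
  rw [hq', hr_def]
  field_simp
  ring

/-- `∑ₙ (r z)^{n+1}/(n+1) = -log(1 - r z)` for `|r| < 1`, `‖z‖ = 1`. [folklore] -/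
private theorem hasSum_pow_div_succ (hr : |r| < 1) (hz : ‖z‖ = 1) :
    HasSum (fun n : ℕ => ((r : ℂ) * z) ^ (n + 1) / (n + 1)) (-Complex.log (1 - r * z)) := by
  have hrz : ‖(r : ℂ) * z‖ < 1 := by
    rw [norm_mul, Complex.norm_real, hz, mul_one, Real.norm_eq_abs]; exact hr
  have h := Complex.hasSum_taylorSeries_neg_log hrz
  have h2 := (hasSum_nat_add_iff' 1).2 h
  exact hasSum_of_hasSum_eq h2 (fun n => by push_cast; ring) (by simp)

/-- `log(1 - rz) + log(1 - r z̄) = log(1 - 2 r Re z + r²)` (a real number) for `|r| < 1`,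
`‖z‖ = 1`. [folklore] -/
private theorem log_add_log_conj (hr : |r| < 1) (hz : ‖z‖ = 1) :
    Complex.log (1 - r * z) + Complex.log (1 - r * conj z) =
      ((Real.log (1 - 2 * r * z.re + r ^ 2) : ℝ) : ℂ) := by
  set w : ℂ := 1 - r * z with hw
  have hconj : 1 - (r : ℂ) * conj z = conj w := by
    rw [hw, map_sub, map_one, map_mul, Complex.conj_ofReal]
  have hc : |z.re| ≤ 1 := by have := Complex.abs_re_le_norm z; rwa [hz] at this
  have hre : 0 < w.re := by
    rw [hw]
    simp only [Complex.sub_re, Complex.one_re, Complex.mul_re, Complex.ofReal_re, Complex.ofReal_im,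
      zero_mul, sub_zero]
    have h1 : |r * z.re| < 1 := by
      rw [abs_mul]
      calc |r| * |z.re| ≤ |r| * 1 := mul_le_mul_of_nonneg_left hc (abs_nonneg r)
        _ < 1 := by rw [mul_one]; exact hr
    linarith [(abs_lt.1 h1).2]
  have harg : w.arg ≠ Real.pi := by
    intro h
    rw [Complex.arg_eq_pi_iff] at h
    linarith [h.1]
  rw [hconj, Complex.log_conj w harg, Complex.add_conj, Complex.log_re]
  have h2 : 2 * Real.log ‖w‖ = Real.log (1 - 2 * r * z.re + r ^ 2) := by
    have h3 : Real.log (‖w‖ ^ 2) = 2 * Real.log ‖w‖ := by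
      rw [Real.log_pow]; norm_num
    rw [← h3, Complex.sq_norm, hw, normSq_one_sub_mul r hz]
  exact_mod_cast h2


/-! ## §C The explicit witness on `T¹`: closed forms, smoothness, the transport equation -/

section Witness

/-- The unit vector `e₀` of `ℝ¹`. [folklore] -/
def e0 : EuclideanSpace ℝ (Fin 1) := EuclideanSpace.single 0 1

/-- `e₀` has the coordinate `1`. [folklore] -/
@[simp] private theorem e0_apply (i : Fin 1) : e0 i = 1 := by
  rw [e0, Subsingleton.elim i 0]; simp

/-- `‖r • e₀‖ = |r|`. [folklore] -/
@[simp] private theorem norm_smul_e0 (r : ℝ) : ‖r • e0‖ = |r| := by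
  rw [norm_smul, e0, Real.norm_eq_abs]; simp

/-- The quadratic form `D_ν(y) = (1 + ν²) + (1 - ν²) cos(2π y₀)` (`= ((ν+1)²/2)|1 - r_ν e^{2πiy₀}|²`,
`r_ν = (ν-1)/(ν+1)`). [folklore] -/
def Dfun (ν : ℝ) (y : UnitAddTorus (Fin 1)) : ℝ := (1 + ν ^ 2) + (1 - ν ^ 2) * cosCoord 0 y

/-- The Poisson-type profile `g_ν = (1 + cos θ)/D_ν` (`= 1/(1 + ν² tan²(θ/2))`). [folklore] -/
def gsc (ν : ℝ) (y : UnitAddTorus (Fin 1)) : ℝ := (1 + cosCoord 0 y) / Dfun ν y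

/-- The drift profile `f = -(a/2π) sin θ`. [folklore] -/
def fsc (a : ℝ) (y : UnitAddTorus (Fin 1)) : ℝ := -(a / (2 * Real.pi)) * sinCoord 0 y

/-- The scale parameter `ν(t) = μ e^{a t}` transported by the flow of `f`. [folklore] -/
def nuAt (μ a t : ℝ) : ℝ := μ * Real.exp (a * t)

/-- The explicit solution `Y(t) = t - (1/2a)(log D_{ν(t)} - log D_μ)` of `∂ₜY + f ∂Y = g_μ`, `Y(0) = 0`.
[folklore] -/
def ysc (μ a t : ℝ) (y : UnitAddTorus (Fin 1)) : ℝ :=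
  t - 1 / (2 * a) * (Real.log (Dfun (nuAt μ a t) y) - Real.log (Dfun μ y))

/-- The drift as a (time-independent) vector field on `T¹`. [folklore] -/
def fvec (a : ℝ) : ℝ → UnitAddTorus (Fin 1) → EuclideanSpace ℝ (Fin 1) := fun _ y => fsc a y • e0

/-- The source as a (time-independent) vector field on `T¹`. [folklore] -/
def gvec (μ : ℝ) : ℝ → UnitAddTorus (Fin 1) → EuclideanSpace ℝ (Fin 1) := fun _ y => gsc μ y • e0

/-- The solution as a time-dependent vector field on `T¹`. [folklore] -/
def Yvec (μ a : ℝ) : ℝ → UnitAddTorus (Fin 1) → EuclideanSpace ℝ (Fin 1) := fun t y => ysc μ a t y • e0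

variable {ν μ a : ℝ}

/-- The first character `z = e^{2πi y₀}` has norm one. [folklore] -/
private theorem norm_fourier_one (y : UnitAddTorus (Fin 1)) : ‖(fourier 1 (y 0) : ℂ)‖ = 1 := Circle.norm_coe _

/-- `cos² + sin² = 1` for the coordinate functions. [folklore] -/
private theorem sinCoord_sq_add_cosCoord_sq (y : UnitAddTorus (Fin 1)) : sinCoord 0 y ^ 2 + cosCoord 0 y ^ 2 = 1 := by
  have h := Complex.normSq_apply (fourier 1 (y 0) : ℂ)
  rw [← Complex.sq_norm, norm_fourier_one] at h
  rw [sinCoord, cosCoord]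
  nlinarith [h]

/-- `D_ν = (1 + c) + ν²(1 - c)`. [folklore] -/
private theorem Dfun_eq (ν : ℝ) (y : UnitAddTorus (Fin 1)) :
    Dfun ν y = (1 + cosCoord 0 y) + ν ^ 2 * (1 - cosCoord 0 y) := by
  rw [Dfun]; ring

/-- Positivity of the quadratic form in the variable `c ∈ [-1, 1]`, `ν ≠ 0`. [folklore] -/
private theorem quad_pos (hν : ν ≠ 0) {c : ℝ} (hc : |c| ≤ 1) : 0 < (1 + ν ^ 2) + (1 - ν ^ 2) * c := by
  have hc' := abs_le.1 hc
  have hν2 : 0 < ν ^ 2 := by positivity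
  rcases eq_or_lt_of_le hc'.2 with h | h
  · rw [h]; norm_num
  · nlinarith

/-- `D_ν > 0` for `ν ≠ 0`. [folklore] -/
private theorem Dfun_pos (hν : ν ≠ 0) (y : UnitAddTorus (Fin 1)) : 0 < Dfun ν y :=
  quad_pos hν (abs_cosCoord_le 0 y)

/-- `0 < ν(t)`. [folklore] -/
private theorem nuAt_pos (hμ : 0 < μ) (a t : ℝ) : 0 < nuAt μ a t := mul_pos hμ (Real.exp_pos _)

/-- `ν(0) = μ`. [folklore] -/
@[simp] private theorem nuAt_zero (μ a : ℝ) : nuAt μ a 0 = μ := by simp [nuAt]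

/-- `Y(0) = 0`. [folklore] -/
private theorem Yvec_zero (μ a : ℝ) (y : UnitAddTorus (Fin 1)) : Yvec μ a 0 y = 0 := by
  simp [Yvec, ysc]

/-! ### Smoothness -/

/-- The coordinate cosine lifted to `ℝ¹`. [folklore] -/
private theorem cosCoord_proj (x : EuclideanSpace ℝ (Fin 1)) : cosCoord 0 (proj x) = Real.cos (2 * Real.pi * x 0) :=
  cosCoord_of_eq (proj_apply x 0)

/-- The coordinate sine lifted to `ℝ¹`. [folklore] -/
private theorem sinCoord_proj (x : EuclideanSpace ℝ (Fin 1)) : sinCoord 0 (proj x) = Real.sin (2 * Real.pi * x 0) :=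
  sinCoord_of_eq (proj_apply x 0)

/-- `x ↦ cos(2π x₀)` is smooth on `ℝ¹`. [folklore] -/
private theorem contDiff_cosX : ContDiff ℝ ∞ (fun x : EuclideanSpace ℝ (Fin 1) => Real.cos (2 * Real.pi * x 0)) :=
  Real.contDiff_cos.comp (contDiff_const.mul (contDiff_euclidean_apply 0))

/-- The lifted quadratic form is positive. [folklore] -/
private theorem quadX_pos (hν : ν ≠ 0) (x : EuclideanSpace ℝ (Fin 1)) :
    0 < (1 + ν ^ 2) + (1 - ν ^ 2) * Real.cos (2 * Real.pi * x 0) :=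
  quad_pos hν (Real.abs_cos_le_one _)

/-- `D_ν` is smooth (as a function on `ℝ¹` of the parameter-free form). [folklore] -/
private theorem contDiff_quadX (ν : ℝ) :
    ContDiff ℝ ∞ (fun x : EuclideanSpace ℝ (Fin 1) => (1 + ν ^ 2) + (1 - ν ^ 2) * Real.cos (2 * Real.pi * x 0)) :=
  contDiff_const.add (contDiff_const.mul contDiff_cosX)

/-- `g_ν` is smooth on `T¹` (`ν ≠ 0`). [folklore] -/
private theorem isSmooth_gsc (hν : ν ≠ 0) : IsSmooth (gsc ν) := by
  have e : lift (gsc ν) = fun x : EuclideanSpace ℝ (Fin 1) =>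
      (1 + Real.cos (2 * Real.pi * x 0)) / ((1 + ν ^ 2) + (1 - ν ^ 2) * Real.cos (2 * Real.pi * x 0)) := by
    funext x; simp only [lift_apply, gsc, Dfun, cosCoord_proj]
  rw [IsSmooth, e]
  exact (contDiff_const.add contDiff_cosX).div (contDiff_quadX ν) fun x => (quadX_pos hν x).ne'

/-- `f` is smooth on `T¹`. [folklore] -/
private theorem isSmooth_fsc (a : ℝ) : IsSmooth (fsc a) := by
  have e : fsc a = (-(a / (2 * Real.pi))) • sinCoord 0 := by funext y; rfl
  rw [e]; exact (isSmooth_sinCoord 0).smul _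

/-- `log D_ν` is smooth on `T¹` (`ν ≠ 0`). [folklore] -/
private theorem isSmooth_log_Dfun (hν : ν ≠ 0) : IsSmooth (fun y => Real.log (Dfun ν y)) := by
  have e : lift (fun y => Real.log (Dfun ν y)) = fun x : EuclideanSpace ℝ (Fin 1) =>
      Real.log ((1 + ν ^ 2) + (1 - ν ^ 2) * Real.cos (2 * Real.pi * x 0)) := by
    funext x; simp only [lift_apply, Dfun, cosCoord_proj]
  rw [IsSmooth, e]
  exact (contDiff_quadX ν).log fun x => (quadX_pos hν x).ne'

/-- `Y(t)` is smooth on `T¹` for each `t`. [folklore] -/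
private theorem isSmooth_ysc (hμ : 0 < μ) (a t : ℝ) : IsSmooth (ysc μ a t) := by
  have e : ysc μ a t = fun y => t - 1 / (2 * a) * (Real.log (Dfun (nuAt μ a t) y) - Real.log (Dfun μ y)) := rfl
  rw [e]
  exact (isSmooth_const t).sub
    (((isSmooth_log_Dfun (nuAt_pos hμ a t).ne').sub (isSmooth_log_Dfun hμ.ne')).smul (1 / (2 * a)))

/-- `f` as a vector field is smooth. [folklore] -/
private theorem isSmooth_fvec (a t : ℝ) : IsSmooth (fvec a t) := (isSmooth_fsc a).smul' (isSmooth_const e0)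

/-- `g` as a vector field is smooth. [folklore] -/
private theorem isSmooth_gvec (hμ : μ ≠ 0) (t : ℝ) : IsSmooth (gvec μ t) := (isSmooth_gsc hμ).smul' (isSmooth_const e0)

/-- `Y(t)` as a vector field is smooth. [folklore] -/
private theorem isSmooth_Yvec (hμ : 0 < μ) (a t : ℝ) : IsSmooth (Yvec μ a t) :=
  (isSmooth_ysc hμ a t).smul' (isSmooth_const e0)

/-- `f` is jointly smooth in space–time. [folklore] -/
private theorem isSmoothSpaceTimeOn_fvec (a : ℝ) : IsSmoothSpaceTimeOn Set.univ (fvec a) :=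
  isSmoothSpaceTimeOn_const (isSmooth_fvec a 0) _

/-- `g` is jointly smooth in space–time. [folklore] -/
private theorem isSmoothSpaceTimeOn_gvec (hμ : μ ≠ 0) : IsSmoothSpaceTimeOn Set.univ (gvec μ) :=
  isSmoothSpaceTimeOn_const (isSmooth_gvec hμ 0) _

/-- `Y` is jointly smooth in space–time. [folklore] -/
private theorem isSmoothSpaceTimeOn_Yvec (hμ : 0 < μ) (a : ℝ) : IsSmoothSpaceTimeOn Set.univ (Yvec μ a) := by
  refine isSmoothSpaceTimeOn_of_contDiff ?_ _
  have e : stLift (Yvec μ a) = fun p : ℝ × EuclideanSpace ℝ (Fin 1) =>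
      (p.1 - 1 / (2 * a) * (Real.log ((1 + (μ * Real.exp (a * p.1)) ^ 2) +
          (1 - (μ * Real.exp (a * p.1)) ^ 2) * Real.cos (2 * Real.pi * p.2 0)) -
        Real.log ((1 + μ ^ 2) + (1 - μ ^ 2) * Real.cos (2 * Real.pi * p.2 0)))) • e0 := by
    funext p
    simp only [stLift, Yvec, ysc, Dfun, nuAt, cosCoord_proj]
  rw [e]
  have hν : ContDiff ℝ ∞ (fun p : ℝ × EuclideanSpace ℝ (Fin 1) => μ * Real.exp (a * p.1)) :=
    contDiff_const.mul (Real.contDiff_exp.comp (contDiff_const.mul contDiff_fst))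
  have hcos : ContDiff ℝ ∞ (fun p : ℝ × EuclideanSpace ℝ (Fin 1) => Real.cos (2 * Real.pi * p.2 0)) :=
    contDiff_cosX.comp contDiff_snd
  have hD1 : ContDiff ℝ ∞ (fun p : ℝ × EuclideanSpace ℝ (Fin 1) =>
      (1 + (μ * Real.exp (a * p.1)) ^ 2) + (1 - (μ * Real.exp (a * p.1)) ^ 2) * Real.cos (2 * Real.pi * p.2 0)) :=
    (contDiff_const.add (hν.pow 2)).add ((contDiff_const.sub (hν.pow 2)).mul hcos)
  have hD0 : ContDiff ℝ ∞ (fun p : ℝ × EuclideanSpace ℝ (Fin 1) =>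
      (1 + μ ^ 2) + (1 - μ ^ 2) * Real.cos (2 * Real.pi * p.2 0)) :=
    contDiff_const.add (contDiff_const.mul hcos)
  have hne1 : ∀ p : ℝ × EuclideanSpace ℝ (Fin 1),
      (1 + (μ * Real.exp (a * p.1)) ^ 2) + (1 - (μ * Real.exp (a * p.1)) ^ 2) * Real.cos (2 * Real.pi * p.2 0) ≠ 0 :=
    fun p => (quadX_pos (mul_pos hμ (Real.exp_pos _)).ne' p.2).ne'
  have hne0 : ∀ p : ℝ × EuclideanSpace ℝ (Fin 1),
      (1 + μ ^ 2) + (1 - μ ^ 2) * Real.cos (2 * Real.pi * p.2 0) ≠ 0 := fun p => (quadX_pos hμ.ne' p.2).ne'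
  exact (contDiff_fst.sub (((hD1.log hne1).sub (hD0.log hne0)).const_smul (1 / (2 * a)))).smul contDiff_const

/-! ### The transport equation `∂ₜY = g - (f·∇)Y` -/

/-- Time derivative of the scalar solution: `∂ₜ Y(t,y) = g_{ν(t)}(y)`. [folklore] -/
private theorem hasDerivAt_ysc (hμ : 0 < μ) (ha : a ≠ 0) (t : ℝ) (y : UnitAddTorus (Fin 1)) :
    HasDerivAt (fun s => ysc μ a s y) (gsc (nuAt μ a t) y) t := by
  set c : ℝ := cosCoord 0 y with hc
  have hνd : HasDerivAt (fun s => μ * Real.exp (a * s)) (μ * (Real.exp (a * t) * (a * 1))) t :=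
    ((Real.hasDerivAt_exp (a * t)).comp t ((hasDerivAt_id t).const_mul a)).const_mul μ
  have hsq : HasDerivAt (fun s => (μ * Real.exp (a * s)) ^ 2)
      (((2 : ℕ) : ℝ) * (μ * Real.exp (a * t)) ^ (2 - 1) * (μ * (Real.exp (a * t) * (a * 1)))) t := hνd.pow 2
  have hD : HasDerivAt (fun s => (1 + (μ * Real.exp (a * s)) ^ 2) + (1 - (μ * Real.exp (a * s)) ^ 2) * c)
      ((((2 : ℕ) : ℝ) * (μ * Real.exp (a * t)) ^ (2 - 1) * (μ * (Real.exp (a * t) * (a * 1)))) +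
        (-(((2 : ℕ) : ℝ) * (μ * Real.exp (a * t)) ^ (2 - 1) * (μ * (Real.exp (a * t) * (a * 1))))) * c) t :=
    (hsq.const_add 1).add ((hsq.const_sub 1).mul_const c)
  have hDne : (1 + (μ * Real.exp (a * t)) ^ 2) + (1 - (μ * Real.exp (a * t)) ^ 2) * c ≠ 0 :=
    (quad_pos (mul_pos hμ (Real.exp_pos _)).ne' (abs_cosCoord_le 0 y)).ne'
  have hlog := hD.log hDne
  have hfull := (hasDerivAt_id t).sub ((hlog.sub_const (Real.log (Dfun μ y))).const_mul (1 / (2 * a)))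
  have e : (fun s => ysc μ a s y) = fun s => s - 1 / (2 * a) *
      (Real.log ((1 + (μ * Real.exp (a * s)) ^ 2) + (1 - (μ * Real.exp (a * s)) ^ 2) * c) - Real.log (Dfun μ y)) := by
    funext s; simp only [ysc, Dfun, nuAt, hc]
  rw [e]
  refine hfull.congr_deriv ?_
  rw [gsc, Dfun, nuAt, ← hc]
  set E := Real.exp (a * t) with hE
  set D := 1 + (μ * E) ^ 2 + (1 - (μ * E) ^ 2) * c with hD_def
  have hDne' : D ≠ 0 := hDne
  simp only [show (2 : ℕ) - 1 = 1 from rfl, pow_one, Nat.cast_ofNat, mul_one]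
  field_simp
  rw [hD_def]
  ring

/-- Base point of the coordinate line (restated for `Fin 1`). [folklore] -/
private theorem line0 (y : UnitAddTorus (Fin 1)) : y + proj ((0 : ℝ) • EuclideanSpace.single (0 : Fin 1) (1 : ℝ)) = y :=
  line_zero y _

/-- Space derivative of the scalar solution along the coordinate line. [folklore] -/
private theorem hasDerivAt_ysc_line (hμ : 0 < μ) (a t : ℝ) (y : UnitAddTorus (Fin 1)) :
    HasDerivAt (fun s : ℝ => ysc μ a t (y + proj (s • EuclideanSpace.single (0 : Fin 1) (1 : ℝ))))
      (-(1 / (2 * a) * (((1 - nuAt μ a t ^ 2) * (-(2 * Real.pi) * sinCoord 0 y)) / Dfun (nuAt μ a t) y -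
        ((1 - μ ^ 2) * (-(2 * Real.pi) * sinCoord 0 y)) / Dfun μ y))) 0 := by
  have hcos := (isSmooth_cosCoord (d := Fin 1) 0).hasDerivAt_line_zero 0 y
  rw [partialDeriv_cosCoord, if_pos rfl] at hcos
  have hD : ∀ ν : ℝ, HasDerivAt (fun s : ℝ => Dfun ν (y + proj (s • EuclideanSpace.single (0 : Fin 1) (1 : ℝ))))
      ((1 - ν ^ 2) * (-(2 * Real.pi) * sinCoord 0 y)) 0 := fun ν => by
    have := (hcos.const_mul (1 - ν ^ 2)).const_add (1 + ν ^ 2)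
    exact this
  have hlog : ∀ ν : ℝ, ν ≠ 0 → HasDerivAt (fun s : ℝ => Real.log (Dfun ν (y + proj (s • EuclideanSpace.single (0 : Fin 1) (1 : ℝ)))))
      (((1 - ν ^ 2) * (-(2 * Real.pi) * sinCoord 0 y)) / Dfun ν y) 0 := fun ν hν => by
    have h := (hD ν).log (by rw [line0]; exact (Dfun_pos hν y).ne')
    rw [line0] at h
    exact h
  have h := ((hlog _ (nuAt_pos hμ a t).ne').sub (hlog μ hμ.ne')).const_mul (1 / (2 * a))
  exact h.const_sub t

/-- `∂₀ Y(t,y)` in closed form. [folklore] -/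
private theorem partialDeriv_ysc (hμ : 0 < μ) (a t : ℝ) (y : UnitAddTorus (Fin 1)) :
    partialDeriv 0 (ysc μ a t) y =
      -(1 / (2 * a) * (((1 - nuAt μ a t ^ 2) * (-(2 * Real.pi) * sinCoord 0 y)) / Dfun (nuAt μ a t) y -
        ((1 - μ ^ 2) * (-(2 * Real.pi) * sinCoord 0 y)) / Dfun μ y)) := by
  rw [partialDeriv, Torus.lineDeriv]
  exact (hasDerivAt_ysc_line hμ a t y).deriv

/-- The map `r ↦ r • e₀` as a continuous linear map. [folklore] -/
def smulE0 : ℝ →L[ℝ] EuclideanSpace ℝ (Fin 1) := (ContinuousLinearMap.id ℝ ℝ).smulRight e0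

/-- `smulE0 r = r • e₀`. [folklore] -/
@[simp] private theorem smulE0_apply (r : ℝ) : smulE0 r = r • e0 := rfl

/-- `∂₀ (φ • e₀) = (∂₀ φ) • e₀` for smooth scalar `φ`. [folklore] -/
private theorem partialDeriv_smul_e0 {φ : UnitAddTorus (Fin 1) → ℝ} (hφ : IsSmooth φ) (y : UnitAddTorus (Fin 1)) :
    partialDeriv 0 (fun y => φ y • e0) y = partialDeriv 0 φ y • e0 := by
  have e : (fun y => φ y • e0) = (smulE0 ∘ φ) := by funext y; simp
  rw [e, partialDeriv_clm_comp hφ smulE0 0 y, smulE0_apply]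

/-- The convective term `(f·∇)Y(t)` in closed form. [folklore] -/
private theorem convect_fvec_Yvec (hμ : 0 < μ) (a t t' : ℝ) (y : UnitAddTorus (Fin 1)) :
    convect (fvec a t') (Yvec μ a t) y = (fsc a y * partialDeriv 0 (ysc μ a t) y) • e0 := by
  have hY1 : IsContDiff 1 (Yvec μ a t) := (isSmooth_Yvec hμ a t).isContDiff (by simp)
  rw [show convect (fvec a t') (Yvec μ a t) y = Torus.fderiv (Yvec μ a t) y (fvec a t' y) from rfl,
    fderiv_apply_eq_sum_partialDeriv hY1, Fin.sum_univ_one]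
  rw [show Yvec μ a t = fun y => ysc μ a t y • e0 from rfl, partialDeriv_smul_e0 (isSmooth_ysc hμ a t),
    smul_smul]
  congr 1
  simp [fvec]

/-- The algebra of the invariance of the Poisson family under the flow of `f`:
`g_μ - f ∂₀Y(t) = g_{ν(t)}`. [folklore] -/
private theorem gsc_sub_convect (hμ : 0 < μ) (ha : a ≠ 0) (t : ℝ) (y : UnitAddTorus (Fin 1)) :
    gsc μ y - fsc a y * partialDeriv 0 (ysc μ a t) y = gsc (nuAt μ a t) y := by
  set ν := nuAt μ a t with hν
  set c := cosCoord 0 y with hc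
  set s := sinCoord 0 y with hs
  have hνpos : 0 < ν := nuAt_pos hμ a t
  have hDν : Dfun ν y ≠ 0 := (Dfun_pos hνpos.ne' y).ne'
  have hDμ : Dfun μ y ≠ 0 := (Dfun_pos hμ.ne' y).ne'
  have hπ : Real.pi ≠ 0 := Real.pi_ne_zero
  have key : fsc a y * partialDeriv 0 (ysc μ a t) y =
      -(s ^ 2 / 2) * ((1 - ν ^ 2) / Dfun ν y - (1 - μ ^ 2) / Dfun μ y) := by
    rw [partialDeriv_ysc hμ a t y, fsc, ← hν, ← hs]
    field_simp
    ring
  have hs2 : s ^ 2 = 1 - c ^ 2 := by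
    have := sinCoord_sq_add_cosCoord_sq y; rw [← hs, ← hc] at this; linarith
  rw [key, hs2, gsc, gsc, ← hc]
  set Dn := Dfun ν y with hDn
  set Dm := Dfun μ y with hDm
  field_simp
  rw [hDn, hDm, Dfun_eq, Dfun_eq, ← hc]
  ring

/-- **The transport equation** `∂ₜ Y = g - (f·∇) Y` holds pointwise for all `t`. [folklore] -/
private theorem hasDerivAt_Yvec (hμ : 0 < μ) (ha : a ≠ 0) (t : ℝ) (y : UnitAddTorus (Fin 1)) :
    HasDerivAt (fun s => Yvec μ a s y) (gvec μ t y - convect (fvec a t) (Yvec μ a t) y) t := by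
  have h := (hasDerivAt_ysc hμ ha t y).smul_const e0
  refine h.congr_deriv ?_
  rw [convect_fvec_Yvec hμ a t t y, show gvec μ t y = gsc μ y • e0 from rfl, ← sub_smul,
    gsc_sub_convect hμ ha t y]

end Witness

/-! ## §D Characters and Fourier series on `T¹` -/

section Characters

/-- On `T¹` a multi-character is the character of the single coordinate. [folklore] -/
private theorem mFourier_fin_one (k : Fin 1 → ℤ) (y : UnitAddTorus (Fin 1)) : mFourier k y = fourier (k 0) (y 0) := by
  simp [mFourier]

/-- `e_n = e_1^n` for `n ≥ 0`. [folklore] -/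
private theorem fourier_natCast (n : ℕ) (x : UnitAddCircle) : (fourier (n : ℤ) x : ℂ) = (fourier 1 x : ℂ) ^ n := by
  induction n with
  | zero => simp
  | succ n ih => rw [Nat.cast_succ, fourier_add, ih, pow_succ]

/-- `e_{-n} = conj(e_1)^n`. [folklore] -/
private theorem fourier_neg_natCast (n : ℕ) (x : UnitAddCircle) :
    (fourier (-(n : ℤ)) x : ℂ) = (conj (fourier 1 x : ℂ)) ^ n := by
  rw [fourier_neg, fourier_natCast, map_pow]

/-- Multi-characters equal `1` at the origin. [folklore] -/
private theorem mFourier_at_zero (k : Fin 1 → ℤ) : mFourier k (0 : UnitAddTorus (Fin 1)) = 1 := by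
  rw [mFourier_fin_one]; exact fourier_eval_zero _

/-- The identification `ℤ ≃ (Fin 1 → ℤ)`. [folklore] -/
def zEquiv : ℤ ≃ (Fin 1 → ℤ) where
  toFun m := fun _ => m
  invFun k := k 0
  left_inv m := rfl
  right_inv k := funext fun i => by rw [Subsingleton.elim i 0]

/-- `zEquiv m i = m`. [folklore] -/
@[simp] private theorem zEquiv_apply (m : ℤ) (i : Fin 1) : zEquiv m i = m := rfl

/-- Transfer of a `HasSum` from `ℤ` to `Fin 1 → ℤ`. [folklore] -/
private theorem hasSum_of_int {M : Type*} [AddCommMonoid M] [TopologicalSpace M] {F : (Fin 1 → ℤ) → M} {a : M}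
    (h : HasSum (fun m : ℤ => F (zEquiv m)) a) : HasSum F a :=
  (Equiv.hasSum_iff zEquiv).1 h

/-- Transfer of summability from `ℤ` to `Fin 1 → ℤ`. [folklore] -/
private theorem summable_of_int {M : Type*} [AddCommMonoid M] [TopologicalSpace M] {F : (Fin 1 → ℤ) → M}
    (h : Summable (fun m : ℤ => F (zEquiv m))) : Summable F :=
  (Equiv.summable_iff zEquiv).1 h

end Characters

/-! ## §E Derivatives of smooth functions on the torus through their Fourier series -/

section FourierDerivatives

variable {d : Type*} [Fintype d] [DecidableEq d]
variable {V : Type*} [NormedAddCommGroup V] [NormedSpace ℂ V] [CompleteSpace V]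

omit [Fintype d] [CompleteSpace V] in
/-- `(∂ⱼ)^[m] G = ∂^{[j,…,j]} G`. [folklore] -/
private theorem iterate_partialDeriv_eq (j : d) (m : ℕ) (G : UnitAddTorus d → V) :
    (partialDeriv j)^[m] G = iterPartialDeriv (List.replicate m j) G := by
  induction m with
  | zero => rfl
  | succ m ih =>
    rw [Function.iterate_succ', Function.comp_apply, ih, List.replicate_succ, iterPartialDeriv_cons]

/-- **Pointwise Fourier expansion of a pure iterated derivative** of a smooth `V`-valued function:
`∂ⱼⁿ G(y) = ∑_k e_k(y) (2πi kⱼ)ⁿ Ĝ(k)`. [cite: Grafakos2014, Prop. 3.1.2 (10) and Prop. 3.2.5] -/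
theorem hasSum_iterPartialDeriv_replicate {G : UnitAddTorus d → V} (hG : IsSmooth G) (j : d) (n : ℕ)
    (y : UnitAddTorus d) :
    HasSum (fun k : d → ℤ => mFourier k y • ((2 * Real.pi * Complex.I * (k j)) ^ n • mFourierCoeff G k))
      (iterPartialDeriv (List.replicate n j) G y) := by
  have hH : IsSmooth (iterPartialDeriv (List.replicate n j) G) := hG.iterPartialDeriv _
  have e := congrFun hH.fourierSynth_mFourierCoeff y
  have hs := hH.rapidDecay_mFourierCoeff.hasSum_fourierSynth y
  rw [e] at hs
  refine hasSum_of_hasSum_eq hs (fun k => ?_) rfl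
  rw [← iterate_partialDeriv_eq, mFourierCoeff_partialDeriv_iterate hG j n k]

/-- **Sup bound of a pure iterated derivative by the weighted `ℓ¹` norm of the coefficients**:
`‖∂ⱼⁿ G(y)‖ ≤ ∑_k (2π|kⱼ|)ⁿ ‖Ĝ(k)‖` (the converse companion of `Torus.norm_mFourierCoeff_mul_pow_le_derivSup`).
[cite: Grafakos2014, Prop. 3.1.2 (10) and §3.3.3] -/
theorem norm_iterPartialDeriv_replicate_le_tsum {G : UnitAddTorus d → V} (hG : IsSmooth G) (j : d) (n : ℕ)
    (y : UnitAddTorus d)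
    (hs : Summable fun k : d → ℤ => (2 * Real.pi * |(k j : ℝ)|) ^ n * ‖mFourierCoeff G k‖) :
    ‖iterPartialDeriv (List.replicate n j) G y‖ ≤ ∑' k : d → ℤ, (2 * Real.pi * |(k j : ℝ)|) ^ n * ‖mFourierCoeff G k‖ := by
  refine (hasSum_iterPartialDeriv_replicate hG j n y).norm_le_of_bounded hs.hasSum fun k => ?_
  rw [norm_mFourier_smul, norm_smul, norm_pow]
  have e : ‖(2 * Real.pi * Complex.I * (k j) : ℂ)‖ = 2 * Real.pi * |(k j : ℝ)| := by
    rw [norm_mul, norm_mul, norm_mul, Complex.norm_I, mul_one, Complex.norm_ofNat, Complex.norm_real,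
      Real.norm_of_nonneg Real.pi_pos.le, Complex.norm_intCast]
  rw [e]

variable {F' G' : Type*} [NormedAddCommGroup F'] [NormedSpace ℝ F'] [NormedAddCommGroup G'] [NormedSpace ℝ G']

/-- `∂^l (L ∘ f) = L ∘ ∂^l f` for a continuous linear `L` and smooth `f`. [folklore] -/
private theorem iterPartialDeriv_clm_comp' {f : UnitAddTorus d → F'} (hf : IsSmooth f) (L : F' →L[ℝ] G') :
    ∀ l : List d, iterPartialDeriv l (L ∘ f) = L ∘ iterPartialDeriv l f
  | [] => rfl
  | i :: l => by
    rw [iterPartialDeriv_cons, iterPartialDeriv_cons, iterPartialDeriv_clm_comp' hf L l]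
    funext y
    exact partialDeriv_clm_comp (hf.iterPartialDeriv l) L i y

end FourierDerivatives

/-! ## §F The real scalar functions of the witness seen as complex functions / vector fields -/

section Bridge

/-- Complexification of a real scalar function. [folklore] -/
def cplx (φ : UnitAddTorus (Fin 1) → ℝ) : UnitAddTorus (Fin 1) → ℂ := fun y => (φ y : ℂ)

/-- `cplx φ = ofRealCLM ∘ φ`. [folklore] -/
private theorem cplx_eq (φ : UnitAddTorus (Fin 1) → ℝ) : cplx φ = (Complex.ofRealCLM ∘ φ) := rfl

/-- `cplx φ` is smooth for smooth `φ`. [folklore] -/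
private theorem isSmooth_cplx {φ : UnitAddTorus (Fin 1) → ℝ} (hφ : IsSmooth φ) : IsSmooth (cplx φ) := by
  rw [cplx_eq]; exact hφ.comp_clm _

/-- `∂^l (cplx φ) = cplx (∂^l φ)`. [folklore] -/
private theorem iterPartialDeriv_cplx {φ : UnitAddTorus (Fin 1) → ℝ} (hφ : IsSmooth φ) (l : List (Fin 1))
    (y : UnitAddTorus (Fin 1)) : iterPartialDeriv l (cplx φ) y = ((iterPartialDeriv l φ y : ℝ) : ℂ) := by
  rw [cplx_eq, iterPartialDeriv_clm_comp' hφ Complex.ofRealCLM l]; rfl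

/-- `∂^l (φ • e₀) = (∂^l φ) • e₀`. [folklore] -/
private theorem iterPartialDeriv_smul_e0 {φ : UnitAddTorus (Fin 1) → ℝ} (hφ : IsSmooth φ) (l : List (Fin 1))
    (y : UnitAddTorus (Fin 1)) : iterPartialDeriv l (fun y => φ y • e0) y = iterPartialDeriv l φ y • e0 := by
  have e : (fun y => φ y • e0) = (smulE0 ∘ φ) := by funext y; simp
  rw [e, iterPartialDeriv_clm_comp' hφ smulE0 l]; rfl

/-- Every word over the one-letter alphabet is a pure power. [folklore] -/
private theorem eq_replicate (l : List (Fin 1)) : l = List.replicate l.length 0 :=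
  List.eq_replicate_iff.2 ⟨rfl, fun b _ => Subsingleton.elim b 0⟩

/-- **Sup bound for the derivatives of a real scalar function on `T¹` through its Fourier coefficients.**
[cite: Grafakos2014, Prop. 3.1.2 (10) and §3.3.3] -/
theorem norm_iterPartialDeriv_le_tsum_cplx {φ : UnitAddTorus (Fin 1) → ℝ} (hφ : IsSmooth φ) {l : List (Fin 1)}
    {n : ℕ} (hl : l.length = n) (y : UnitAddTorus (Fin 1))
    (hs : Summable fun k : Fin 1 → ℤ => (2 * Real.pi * |(k 0 : ℝ)|) ^ n * ‖mFourierCoeff (cplx φ) k‖) :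
    ‖iterPartialDeriv l φ y‖ ≤ ∑' k : Fin 1 → ℤ, (2 * Real.pi * |(k 0 : ℝ)|) ^ n * ‖mFourierCoeff (cplx φ) k‖ := by
  subst hl
  have h := norm_iterPartialDeriv_replicate_le_tsum (isSmooth_cplx hφ) 0 l.length y hs
  rw [← eq_replicate, iterPartialDeriv_cplx hφ, Complex.norm_real] at h
  exact h

end Bridge

/-! ## §G The hypotheses on the drift `f = -(a/2π) sin θ` -/

section Drift

/-- Derivative of a trigonometric combination along the coordinate line. [folklore] -/
private theorem partialDeriv_trig (u v : ℝ) (y : UnitAddTorus (Fin 1)) :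
    partialDeriv 0 (fun y => u * sinCoord 0 y + v * cosCoord 0 y) y =
      2 * Real.pi * ((-v) * sinCoord 0 y + u * cosCoord 0 y) := by
  have hs := (isSmooth_sinCoord (d := Fin 1) 0).hasDerivAt_line_zero 0 y
  have hc := (isSmooth_cosCoord (d := Fin 1) 0).hasDerivAt_line_zero 0 y
  rw [partialDeriv_sinCoord, if_pos rfl] at hs
  rw [partialDeriv_cosCoord, if_pos rfl] at hc
  have h : HasDerivAt (fun t : ℝ => u * sinCoord 0 (y + proj (t • EuclideanSpace.single (0 : Fin 1) (1 : ℝ))) +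
      v * cosCoord 0 (y + proj (t • EuclideanSpace.single (0 : Fin 1) (1 : ℝ))))
      (u * (2 * Real.pi * cosCoord 0 y) + v * (-(2 * Real.pi) * sinCoord 0 y)) 0 :=
    (hs.const_mul u).add (hc.const_mul v)
  rw [partialDeriv, Torus.lineDeriv, h.deriv]
  ring

/-- **Pure derivatives of trigonometric combinations stay trigonometric combinations of the same
amplitude**: `∂ⁿ(u sin θ + v cos θ) = (2π)ⁿ (u' sin θ + v' cos θ)` with `u'² + v'² = u² + v²`. [folklore] -/
private theorem iterPartialDeriv_trig (u v : ℝ) : ∀ n : ℕ, ∃ u' v' : ℝ, u' ^ 2 + v' ^ 2 = u ^ 2 + v ^ 2 ∧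
    iterPartialDeriv (List.replicate n 0) (fun y : UnitAddTorus (Fin 1) => u * sinCoord 0 y + v * cosCoord 0 y) =
      fun y => (2 * Real.pi) ^ n * (u' * sinCoord 0 y + v' * cosCoord 0 y)
  | 0 => ⟨u, v, rfl, by funext y; simp⟩
  | n + 1 => by
    obtain ⟨u', v', huv, h⟩ := iterPartialDeriv_trig u v n
    refine ⟨-v', u', by rw [← huv]; ring, ?_⟩
    rw [List.replicate_succ, iterPartialDeriv_cons, h]
    have e : (fun y : UnitAddTorus (Fin 1) => (2 * Real.pi) ^ n * (u' * sinCoord 0 y + v' * cosCoord 0 y)) =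
        fun y => ((2 * Real.pi) ^ n * u') * sinCoord 0 y + ((2 * Real.pi) ^ n * v') * cosCoord 0 y := by
      funext y; ring
    rw [e]
    funext y
    rw [partialDeriv_trig, pow_succ]
    ring

/-- **Sup bound of all derivatives of the drift profile**: `|∂ⁿ f| ≤ (a/2π)(2π)ⁿ` (`a ≥ 0`). [folklore] -/
private theorem norm_iterPartialDeriv_fsc_le {a : ℝ} (ha : 0 ≤ a) {l : List (Fin 1)} {n : ℕ} (hl : l.length = n)
    (y : UnitAddTorus (Fin 1)) : ‖iterPartialDeriv l (fsc a) y‖ ≤ a / (2 * Real.pi) * (2 * Real.pi) ^ n := by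
  obtain ⟨u', v', huv, h⟩ := iterPartialDeriv_trig (-(a / (2 * Real.pi))) 0 n
  have e : fsc a = fun y : UnitAddTorus (Fin 1) => -(a / (2 * Real.pi)) * sinCoord 0 y + 0 * cosCoord 0 y := by
    funext y; simp [fsc]
  rw [eq_replicate l, hl, e, h]
  have hsc := sinCoord_sq_add_cosCoord_sq y
  have hamp : u' ^ 2 + v' ^ 2 = (a / (2 * Real.pi)) ^ 2 := by rw [huv]; ring
  have hcs : (u' * sinCoord 0 y + v' * cosCoord 0 y) ^ 2 ≤ (a / (2 * Real.pi)) ^ 2 := by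
    nlinarith [sq_nonneg (u' * cosCoord 0 y - v' * sinCoord 0 y)]
  have ha' : 0 ≤ a / (2 * Real.pi) := by positivity
  have habs : |u' * sinCoord 0 y + v' * cosCoord 0 y| ≤ a / (2 * Real.pi) := by
    refine abs_le.2 ⟨?_, ?_⟩ <;>
      nlinarith [sq_nonneg (u' * sinCoord 0 y + v' * cosCoord 0 y + a / (2 * Real.pi)),
        sq_nonneg (u' * sinCoord 0 y + v' * cosCoord 0 y - a / (2 * Real.pi))]
  rw [Real.norm_eq_abs, abs_mul, abs_pow, abs_of_pos (by positivity : (0 : ℝ) < 2 * Real.pi), mul_comm]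
  exact mul_le_mul_of_nonneg_right habs (by positivity)

/-- **The drift hypothesis** `⟦f⟧_{n,4π} ≤ 1` for every `n`, with `a = π` (so that `4a/R_f = C_f = 1`):
`(n+1)² (a/2π)(2π)ⁿ/(n!(4π)ⁿ) = (n+1)²/(2ⁿ⁺¹ n!) ≤ 1`. [folklore] -/
private theorem dnorm_fvec_le (n : ℕ) (t : ℝ) : dnorm n (4 * Real.pi) (fvec Real.pi t) ≤ 1 := by
  have hR : (0 : ℝ) < 4 * Real.pi := by positivity
  refine dnorm_le_of_forall_norm_iterPartialDeriv_le hR zero_le_one fun l hl y => ?_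
  rw [show fvec Real.pi t = fun y => fsc Real.pi y • e0 from rfl, iterPartialDeriv_smul_e0 (isSmooth_fsc _) l y,
    norm_smul_e0, ← Real.norm_eq_abs]
  refine (norm_iterPartialDeriv_fsc_le Real.pi_pos.le hl y).trans ?_
  have h2 := succ_sq_le_two_pow_mul_factorial n
  have hfac : (0 : ℝ) < n.factorial := by exact_mod_cast Nat.factorial_pos n
  rw [le_div_iff₀ (by positivity), show (4 * Real.pi) ^ n = 2 ^ n * (2 * Real.pi) ^ n by rw [← mul_pow]; ring]
  have hp : (0 : ℝ) < (2 * Real.pi) ^ n := by positivity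
  calc Real.pi / (2 * Real.pi) * (2 * Real.pi) ^ n * ((n : ℝ) + 1) ^ 2
      = (2 * Real.pi) ^ n / 2 * ((n : ℝ) + 1) ^ 2 := by field_simp
    _ ≤ (2 * Real.pi) ^ n / 2 * (2 ^ (n + 1) * (n.factorial : ℝ)) := by gcongr
    _ = 1 * ((n.factorial : ℝ) * (2 ^ n * (2 * Real.pi) ^ n)) := by rw [pow_succ]; ring

end Drift

/-! ## §H Rapid decay of geometric coefficient families on `T¹` -/

section Geometric

variable {V : Type*} [NormedAddCommGroup V] [NormedSpace ℂ V]

/-- `|k|² = k₀²` on `ℤ¹`. [folklore] -/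
private theorem freqNormSq_fin_one (k : Fin 1 → ℤ) : freqNormSq k = ((k 0 : ℤ) : ℝ) ^ 2 := by
  simp [freqNormSq]

omit [NormedSpace ℂ V] in
/-- **Geometrically dominated families on `ℤ¹` decay rapidly.** [folklore] -/
private theorem rapidDecay_of_le_geometric {c : (Fin 1 → ℤ) → V} {C ρ : ℝ} (hρ0 : 0 ≤ ρ) (hρ1 : ρ < 1)
    (h : ∀ k, ‖c k‖ ≤ C * ρ ^ (k 0).natAbs) : RapidDecay c := by
  intro M
  have hC : 0 ≤ C := by
    have := (norm_nonneg _).trans (h (fun _ => 0))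
    simpa using this
  -- comparison family `G m = C (m+1)^{2M} ρ^m` on `ℕ`
  have hG : Summable (fun m : ℕ => C * ((((m + 1 : ℕ) : ℝ)) ^ (2 * M) * ρ ^ m)) :=
    (summable_succ_pow_mul_pow (2 * M) hρ0 hρ1).mul_left C
  have hG1 : Summable (fun m : ℕ => C * ((((m + 1 + 1 : ℕ) : ℝ)) ^ (2 * M) * ρ ^ (m + 1))) :=
    (summable_nat_add_iff 1).2 hG
  have hZ : Summable (fun m : ℤ => C * ((((m.natAbs + 1 : ℕ) : ℝ)) ^ (2 * M) * ρ ^ m.natAbs)) := by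
    refine Summable.of_nat_of_neg_add_one ?_ ?_
    · simpa using hG
    · refine hG1.congr fun m => ?_
      have : (-((m : ℤ) + 1)).natAbs = m + 1 := by
        rw [Int.natAbs_neg]; exact Int.natAbs_natCast (m + 1)
      rw [this]
  refine Summable.of_nonneg_of_le (fun k => mul_nonneg (one_add_freqNormSq_pow_nonneg k M) (norm_nonneg _))
    (fun k => ?_) (summable_of_int (F := fun k : Fin 1 → ℤ =>
      C * ((((( k 0).natAbs + 1 : ℕ) : ℝ)) ^ (2 * M) * ρ ^ (k 0).natAbs)) (by simpa using hZ))
  -- the pointwise comparison `(1 + k₀²)^M ‖c k‖ ≤ C (|k₀|+1)^{2M} ρ^{|k₀|}`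
  have hk : (1 + freqNormSq k) ≤ ((((k 0).natAbs + 1 : ℕ) : ℝ)) ^ 2 := by
    rw [freqNormSq_fin_one]
    have e : (((k 0).natAbs : ℕ) : ℝ) ^ 2 = (((k 0 : ℤ) : ℝ)) ^ 2 := by
      rw [Nat.cast_natAbs, Int.cast_abs, sq_abs]
    have hx : (0 : ℝ) ≤ (((k 0).natAbs : ℕ) : ℝ) := Nat.cast_nonneg _
    rw [← e]; push_cast; nlinarith
  calc (1 + freqNormSq k) ^ M * ‖c k‖ ≤ (((((k 0).natAbs + 1 : ℕ) : ℝ)) ^ 2) ^ M * (C * ρ ^ (k 0).natAbs) :=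
        mul_le_mul (pow_le_pow_left₀ (by linarith [freqNormSq_nonneg k]) hk M) (h k) (norm_nonneg _)
          (by positivity)
    _ = C * ((((( k 0).natAbs + 1 : ℕ) : ℝ)) ^ (2 * M) * ρ ^ (k 0).natAbs) := by rw [← pow_mul]; ring

end Geometric

/-! ## §I The Fourier coefficients of the source `g_ν` and the bound on its derivatives -/

section Source

/-- The ratio `r_ν = (ν - 1)/(ν + 1)` of the Poisson-type family. [folklore] -/
def rr (ν : ℝ) : ℝ := (ν - 1) / (ν + 1)

/-- The Fourier coefficients of `g_ν`: `ĝ(0) = 1/(ν+1)`, `ĝ(±m) = ν r_ν^{m-1}/(ν+1)²`. [folklore] -/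
def ghat (ν : ℝ) (m : ℤ) : ℝ := if m = 0 then 1 / (ν + 1) else ν * rr ν ^ (m.natAbs - 1) / (ν + 1) ^ 2

/-- The coefficient family of `g_ν` on `ℤ¹`. [folklore] -/
def gcoef (ν : ℝ) : (Fin 1 → ℤ) → ℂ := fun k => ((ghat ν (k 0) : ℝ) : ℂ)

variable {ν : ℝ}

/-- `0 < r_ν < 1` for `ν > 1`. [folklore] -/
private theorem rr_pos (hν : 1 < ν) : 0 < rr ν := div_pos (by linarith) (by linarith)

/-- `r_ν < 1`. [folklore] -/
private theorem rr_lt_one (hν : 1 < ν) : rr ν < 1 := by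
  rw [rr, div_lt_one (by linarith)]; linarith

/-- `|r_ν| < 1`. [folklore] -/
private theorem abs_rr_lt_one (hν : 1 < ν) : |rr ν| < 1 := by
  rw [abs_of_pos (rr_pos hν)]; exact rr_lt_one hν

/-- `1 - r_ν = 2/(ν+1)`. [folklore] -/
private theorem one_sub_rr (hν : 1 < ν) : 1 - rr ν = 2 / (ν + 1) := by
  rw [rr]; field_simp; ring

/-- `r_ν/(1 - r_ν) = (ν - 1)/2`. [folklore] -/
private theorem rr_div_one_sub_rr (hν : 1 < ν) : rr ν / (1 - rr ν) = (ν - 1) / 2 := by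
  rw [one_sub_rr hν, rr]; field_simp

/-- `ĝ(±(n+1)) = ν r^n/(ν+1)²`. [folklore] -/
private theorem ghat_succ (ν : ℝ) (n : ℕ) : ghat ν ((n : ℤ) + 1) = ν * rr ν ^ n / (ν + 1) ^ 2 := by
  have h1 : ((n : ℤ) + 1) ≠ 0 := by omega
  have h2 : ((n : ℤ) + 1).natAbs = n + 1 := by
    rw [show ((n : ℤ) + 1) = ((n + 1 : ℕ) : ℤ) by push_cast; ring]; exact Int.natAbs_natCast _
  rw [ghat, if_neg h1, h2, Nat.add_sub_cancel]

/-- `ĝ(-(n+1)) = ν r^n/(ν+1)²`. [folklore] -/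
private theorem ghat_neg_succ (ν : ℝ) (n : ℕ) : ghat ν (-((n : ℤ) + 1)) = ν * rr ν ^ n / (ν + 1) ^ 2 := by
  have h1 : (-((n : ℤ) + 1)) ≠ 0 := by omega
  have h2 : (-((n : ℤ) + 1)).natAbs = n + 1 := by
    rw [Int.natAbs_neg, show ((n : ℤ) + 1) = ((n + 1 : ℕ) : ℤ) by push_cast; ring]; exact Int.natAbs_natCast _
  rw [ghat, if_neg h1, h2, Nat.add_sub_cancel]

/-- `ĝ(0) = 1/(ν+1)`. [folklore] -/
@[simp] private theorem ghat_zero (ν : ℝ) : ghat ν 0 = 1 / (ν + 1) := by rw [ghat, if_pos rfl]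

/-- `|ĝ(m)| ≤ r^{|m|}/r`. [folklore] -/
private theorem abs_ghat_le (hν : 1 < ν) (m : ℤ) : |ghat ν m| ≤ (1 / rr ν) * rr ν ^ m.natAbs := by
  have hr := rr_pos hν
  have hr1 := rr_lt_one hν
  rcases eq_or_ne m 0 with rfl | hm
  · rw [ghat_zero, Int.natAbs_zero, pow_zero, mul_one, abs_of_pos (by positivity)]
    rw [div_le_div_iff₀ (by linarith) hr]; nlinarith
  · rw [ghat, if_neg hm]
    obtain ⟨p, hp⟩ : ∃ p : ℕ, m.natAbs = p + 1 := ⟨m.natAbs - 1, by have := Int.natAbs_pos.2 hm; omega⟩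
    rw [hp, Nat.add_sub_cancel, abs_of_nonneg (by positivity), pow_succ]
    have hν1 : ν / (ν + 1) ^ 2 ≤ 1 := by rw [div_le_one (by positivity)]; nlinarith
    calc ν * rr ν ^ p / (ν + 1) ^ 2 = ν / (ν + 1) ^ 2 * rr ν ^ p := by ring
      _ ≤ 1 * rr ν ^ p := mul_le_mul_of_nonneg_right hν1 (by positivity)
      _ = 1 / rr ν * (rr ν ^ p * rr ν) := by field_simp

/-- The coefficient family of `g_ν` decays rapidly. [folklore] -/
private theorem rapidDecay_gcoef (hν : 1 < ν) : RapidDecay (gcoef ν) :=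
  rapidDecay_of_le_geometric (rr_pos hν).le (rr_lt_one hν) fun k => by
    rw [gcoef, Complex.norm_real, Real.norm_eq_abs]; exact abs_ghat_le hν (k 0)

set_option maxHeartbeats 400000 in
/-- **The Fourier series of `g_ν`** (scalar form over `ℤ`). [folklore] -/
private theorem hasSum_gsc_int (hν : 1 < ν) (y : UnitAddTorus (Fin 1)) :
    HasSum (fun m : ℤ => (fourier m (y 0) : ℂ) * ((ghat ν m : ℝ) : ℂ)) (((gsc ν y : ℝ)) : ℂ) := by
  set z : ℂ := (fourier 1 (y 0) : ℂ) with hz_def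
  set F : ℤ → ℂ := fun m => (fourier m (y 0) : ℂ) * ((ghat ν m : ℝ) : ℂ) with hF
  have hz : ‖z‖ = 1 := norm_fourier_one y
  have hzc : ‖conj z‖ = 1 := by rw [Complex.norm_conj]; exact hz
  have hr := abs_rr_lt_one hν
  have hP : HasSum (fun n : ℕ => F ((n : ℤ) + 1)) ((ν / (ν + 1) ^ 2 : ℂ) * (z / (1 - (rr ν : ℝ) * z))) := by
    refine hasSum_of_hasSum_eq ((hasSum_pow_mul_pow_succ hr hz).mul_left (ν / (ν + 1) ^ 2 : ℂ))
      (fun n => ?_) rfl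
    rw [hF]; simp only
    rw [ghat_succ, show ((n : ℤ) + 1) = ((n + 1 : ℕ) : ℤ) by push_cast; ring, fourier_natCast, ← hz_def]
    push_cast; ring
  have hN : HasSum (fun n : ℕ => F (-((n : ℤ) + 1))) ((ν / (ν + 1) ^ 2 : ℂ) * (conj z / (1 - (rr ν : ℝ) * conj z))) := by
    refine hasSum_of_hasSum_eq ((hasSum_pow_mul_pow_succ hr hzc).mul_left (ν / (ν + 1) ^ 2 : ℂ))
      (fun n => ?_) rfl
    rw [hF]; simp only
    rw [ghat_neg_succ, show ((n : ℤ) + 1) = ((n + 1 : ℕ) : ℤ) by push_cast; ring, fourier_neg_natCast, ← hz_def]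
    push_cast; ring
  have h := HasSum.of_add_one_of_neg_add_one (f := F) hP hN
  refine hasSum_of_hasSum_eq h (fun m => rfl) ?_
  have hF0 : F 0 = ((1 / (ν + 1) : ℝ) : ℂ) := by
    rw [hF]; simp only
    rw [fourier_zero, ghat_zero, one_mul]
  have hD : (1 + ν ^ 2) + (1 - ν ^ 2) * z.re ≠ 0 := (Dfun_pos (by linarith : ν ≠ 0) y).ne'
  have hp := poisson_closed_form (z := z) (by linarith) hz hD
  have hrr : ((rr ν : ℝ) : ℂ) = (((ν - 1) / (ν + 1) : ℝ) : ℂ) := rfl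
  rw [hF0, hrr]
  calc (ν / (ν + 1) ^ 2 : ℂ) * (z / (1 - (((ν - 1) / (ν + 1) : ℝ) : ℂ) * z)) + (((1 / (ν + 1) : ℝ)) : ℂ) +
        (ν / (ν + 1) ^ 2 : ℂ) * (conj z / (1 - (((ν - 1) / (ν + 1) : ℝ) : ℂ) * conj z))
      = (1 / (ν + 1) : ℂ) + (ν / (ν + 1) ^ 2 : ℂ) * (z / (1 - (((ν - 1) / (ν + 1) : ℝ) : ℂ) * z) +
          conj z / (1 - (((ν - 1) / (ν + 1) : ℝ) : ℂ) * conj z)) := by push_cast; ring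
    _ = (((1 + z.re) / ((1 + ν ^ 2) + (1 - ν ^ 2) * z.re) : ℝ) : ℂ) := hp
    _ = ((gsc ν y : ℝ) : ℂ) := by rw [gsc, Dfun, cosCoord, hz_def]

/-- **The Fourier series of `g_ν`** as a synthesis on `T¹`. [folklore] -/
private theorem hasSum_gsc (hν : 1 < ν) (y : UnitAddTorus (Fin 1)) :
    HasSum (fun k : Fin 1 → ℤ => mFourier k y • gcoef ν k) (cplx (gsc ν) y) := by
  refine hasSum_of_int (hasSum_of_hasSum_eq (hasSum_gsc_int hν y) (fun m => ?_) rfl)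
  rw [mFourier_fin_one, zEquiv_apply, gcoef, zEquiv_apply, smul_eq_mul]

/-- `𝓕(g_ν)(k) = ĝ(k₀)`. [folklore] -/
private theorem mFourierCoeff_gsc (hν : 1 < ν) (k : Fin 1 → ℤ) : mFourierCoeff (cplx (gsc ν)) k = gcoef ν k := by
  have e : fourierSynth (gcoef ν) = cplx (gsc ν) := funext fun y => (hasSum_gsc hν y).tsum_eq
  rw [← e]; exact (rapidDecay_gcoef hν).mFourierCoeff_fourierSynth k

/-- **The weighted coefficient sum of `g_ν`**: `∑_k (2π|k₀|)ⁿ |ĝ(k₀)|` converges, with sum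
`2 (2π)ⁿ ν/(ν+1)² ∑_{p≥0} (p+1)ⁿ rᵖ` (`n ≥ 1`). [folklore] -/
private theorem hasSum_weight_gcoef (hν : 1 < ν) {n : ℕ} (hn : 1 ≤ n) :
    HasSum (fun k : Fin 1 → ℤ => (2 * Real.pi * |(k 0 : ℝ)|) ^ n * ‖mFourierCoeff (cplx (gsc ν)) k‖)
      (2 * ((2 * Real.pi) ^ n * (ν / (ν + 1) ^ 2) * ∑' p : ℕ, (((p + 1 : ℕ) : ℝ)) ^ n * rr ν ^ p)) := by
  have hr := rr_pos hν
  have hr1 := rr_lt_one hν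
  set U : ℝ := ∑' p : ℕ, (((p + 1 : ℕ) : ℝ)) ^ n * rr ν ^ p with hU
  have hUsum := (summable_succ_pow_mul_pow n hr.le hr1).hasSum
  have hνp : 0 ≤ ν / (ν + 1) ^ 2 := by positivity
  -- the `ℤ`-indexed weights
  set W : ℤ → ℝ := fun m => (2 * Real.pi * |(m : ℝ)|) ^ n * |ghat ν m| with hW
  have hpart : ∀ m : ℕ, (2 * Real.pi * ((m : ℝ) + 1)) ^ n * (ν * rr ν ^ m / (ν + 1) ^ 2) =
      (2 * Real.pi) ^ n * (ν / (ν + 1) ^ 2) * ((((m + 1 : ℕ) : ℝ)) ^ n * rr ν ^ m) := fun m => by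
    push_cast; rw [mul_pow]; ring
  have hν0 : 0 < ν := by linarith
  have hg0 : ∀ m : ℕ, 0 ≤ ν * rr ν ^ m / (ν + 1) ^ 2 := fun m =>
    div_nonneg (mul_nonneg hν0.le (pow_nonneg hr.le m)) (sq_nonneg _)
  have habsP : ∀ m : ℕ, |((((m : ℤ) + 1 : ℤ)) : ℝ)| = (m : ℝ) + 1 := fun m => by
    push_cast; exact abs_of_nonneg (by positivity)
  have habsN : ∀ m : ℕ, |(((-((m : ℤ) + 1) : ℤ)) : ℝ)| = (m : ℝ) + 1 := fun m => by
    push_cast; rw [abs_neg]; exact abs_of_nonneg (by positivity)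
  have hP : HasSum (fun m : ℕ => W ((m : ℤ) + 1)) ((2 * Real.pi) ^ n * (ν / (ν + 1) ^ 2) * U) := by
    refine hasSum_of_hasSum_eq (hUsum.mul_left ((2 * Real.pi) ^ n * (ν / (ν + 1) ^ 2))) (fun m => ?_) rfl
    rw [hW]; simp only
    rw [habsP, ghat_succ, abs_of_nonneg (hg0 m), hpart m]
  have hN : HasSum (fun m : ℕ => W (-((m : ℤ) + 1))) ((2 * Real.pi) ^ n * (ν / (ν + 1) ^ 2) * U) := by
    refine hasSum_of_hasSum_eq (hUsum.mul_left ((2 * Real.pi) ^ n * (ν / (ν + 1) ^ 2))) (fun m => ?_) rfl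
    rw [hW]; simp only
    rw [habsN, ghat_neg_succ, abs_of_nonneg (hg0 m), hpart m]
  have h0 : W 0 = 0 := by
    rw [hW]; simp only
    rw [Int.cast_zero, abs_zero, mul_zero, zero_pow (by omega), zero_mul]
  have hZ := HasSum.of_add_one_of_neg_add_one hP hN
  rw [h0, add_zero, ← two_mul] at hZ
  refine hasSum_of_int (hasSum_of_hasSum_eq hZ (fun m => ?_) rfl)
  rw [mFourierCoeff_gsc hν, gcoef, zEquiv_apply, Complex.norm_real, Real.norm_eq_abs]

/-- **Sup bound for the derivatives of `g_ν`**: `‖∂^l g_ν‖ ≤ n!(π(ν+1))ⁿ` for words of length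
`n ≥ 1`. [folklore] -/
private theorem norm_iterPartialDeriv_gsc_le (hν : 1 < ν) {l : List (Fin 1)} {n : ℕ} (hl : l.length = n) (hn : 1 ≤ n)
    (y : UnitAddTorus (Fin 1)) :
    ‖iterPartialDeriv l (gsc ν) y‖ ≤ (n.factorial : ℝ) * (Real.pi * (ν + 1)) ^ n := by
  have hr := rr_pos hν
  have hr1 := rr_lt_one hν
  have hW := hasSum_weight_gcoef hν hn
  refine (norm_iterPartialDeriv_le_tsum_cplx (isSmooth_gsc (by linarith)) hl y hW.summable).trans ?_
  rw [hW.tsum_eq]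
  have hU := tsum_succ_pow_mul_pow_le n hr.le hr1
  rw [one_sub_rr hν] at hU
  obtain ⟨m, rfl⟩ : ∃ m, n = m + 1 := ⟨n - 1, by omega⟩
  have hν0 : 0 < ν := by linarith
  have hν1 : ν + 1 ≠ 0 := by linarith
  have h2 : (2 : ℝ) ≠ 0 := two_ne_zero
  have hπ : Real.pi ≠ 0 := Real.pi_ne_zero
  have hfac : (0 : ℝ) < (m + 1).factorial := by exact_mod_cast Nat.factorial_pos _
  calc 2 * ((2 * Real.pi) ^ (m + 1) * (ν / (ν + 1) ^ 2) * ∑' p : ℕ, (((p + 1 : ℕ) : ℝ)) ^ (m + 1) * rr ν ^ p)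
      ≤ 2 * ((2 * Real.pi) ^ (m + 1) * (ν / (ν + 1) ^ 2) * (((m + 1).factorial : ℝ) / (2 / (ν + 1)) ^ (m + 1 + 1))) := by
        gcongr
    _ = ((m + 1).factorial : ℝ) * (Real.pi * (ν + 1)) ^ (m + 1) * (ν / (ν + 1)) := by
        have hν1' : 1 + ν ≠ 0 := by linarith
        rw [div_pow, div_div_eq_mul_div, mul_pow, mul_pow]
        field_simp
        ring
    _ ≤ ((m + 1).factorial : ℝ) * (Real.pi * (ν + 1)) ^ (m + 1) * 1 := by
        gcongr; rw [div_le_one (by linarith)]; linarith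
    _ = ((m + 1).factorial : ℝ) * (Real.pi * (ν + 1)) ^ (m + 1) := mul_one _

/-- **The source hypothesis**: `⟦g_ν⟧_{n, π(ν+1)} ≤ (n+1)²` for `n ≥ 1`. [folklore] -/
private theorem dnorm_gvec_le (hν : 1 < ν) {n : ℕ} (hn : 1 ≤ n) (t : ℝ) :
    dnorm n (Real.pi * (ν + 1)) (gvec ν t) ≤ ((n : ℝ) + 1) ^ 2 := by
  have hR : (0 : ℝ) < Real.pi * (ν + 1) := by have := Real.pi_pos; positivity
  refine dnorm_le_of_forall_norm_iterPartialDeriv_le hR (by positivity) fun l hl y => ?_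
  rw [show gvec ν t = fun y => gsc ν y • e0 from rfl, iterPartialDeriv_smul_e0 (isSmooth_gsc (by linarith)) l y,
    norm_smul_e0, ← Real.norm_eq_abs]
  have hC : ((n : ℝ) + 1) ^ 2 ≠ 0 := by positivity
  rw [show ((n : ℝ) + 1) ^ 2 * ((n.factorial : ℝ) * (Real.pi * (ν + 1)) ^ n) / ((n : ℝ) + 1) ^ 2 =
      (n.factorial : ℝ) * (Real.pi * (ν + 1)) ^ n by field_simp]
  exact norm_iterPartialDeriv_gsc_le hν hl hn y

end Source

/-! ## §J The Fourier coefficients of the solution `Y(T)` (logarithmic series) -/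

section Solution

variable {ν μ a T : ℝ}

/-- The zero mode of `Y(T)`. [folklore] -/
def yzero (μ a T : ℝ) : ℝ :=
  T - 1 / (2 * a) * (Real.log ((nuAt μ a T + 1) ^ 2 / 2) - Real.log ((μ + 1) ^ 2 / 2))

/-- The Fourier coefficients of `Y(T)`: `Ŷ(±m) = (r_{ν(T)}^m - r_μ^m)/(2am)`, `m ≥ 1`. [folklore] -/
def yhat (μ a T : ℝ) (m : ℤ) : ℝ :=
  if m = 0 then yzero μ a T else (rr (nuAt μ a T) ^ m.natAbs - rr μ ^ m.natAbs) / (2 * a * m.natAbs)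

/-- The coefficient family of `Y(T)` on `ℤ¹`. [folklore] -/
def ycoef (μ a T : ℝ) : (Fin 1 → ℤ) → ℂ := fun k => ((yhat μ a T (k 0) : ℝ) : ℂ)

/-- `r` is increasing in `ν`. [folklore] -/
private theorem rr_le_rr (hμ : 1 < μ) (h : μ ≤ ν) : rr μ ≤ rr ν := by
  rw [rr, rr, div_le_div_iff₀ (by linarith) (by linarith)]; nlinarith

/-- `μ ≤ ν(T)` for `a, T ≥ 0`. [folklore] -/
private theorem le_nuAt (hμ : 0 < μ) (ha : 0 ≤ a) (hT : 0 ≤ T) : μ ≤ nuAt μ a T := by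
  rw [nuAt]
  have : 1 ≤ Real.exp (a * T) := Real.one_le_exp (mul_nonneg ha hT)
  nlinarith

/-- The quadratic form through the ratio: `D_ν = ((ν+1)²/2)(1 - 2 r c + r²)`. [folklore] -/
private theorem quad_eq_rr (hν : 1 < ν) (c : ℝ) :
    (1 + ν ^ 2) + (1 - ν ^ 2) * c = (ν + 1) ^ 2 / 2 * (1 - 2 * rr ν * c + rr ν ^ 2) := by
  have hν1 : ν + 1 ≠ 0 := by linarith
  rw [rr]; field_simp; ring

/-- `log D_ν = log((ν+1)²/2) + log(1 - 2rc + r²)`. [folklore] -/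
private theorem log_Dfun (hν : 1 < ν) (y : UnitAddTorus (Fin 1)) :
    Real.log (Dfun ν y) = Real.log ((ν + 1) ^ 2 / 2) + Real.log (1 - 2 * rr ν * cosCoord 0 y + rr ν ^ 2) := by
  rw [Dfun, quad_eq_rr hν]
  exact Real.log_mul (by positivity) (one_sub_two_mul_add_sq_pos (abs_rr_lt_one hν) (abs_cosCoord_le 0 y)).ne'

/-- `Y(T)` through the ratios. [folklore] -/
private theorem ysc_eq (hμ : 1 < μ) (ha : 0 ≤ a) (hT : 0 ≤ T) (y : UnitAddTorus (Fin 1)) :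
    ysc μ a T y = yzero μ a T - 1 / (2 * a) *
      (Real.log (1 - 2 * rr (nuAt μ a T) * cosCoord 0 y + rr (nuAt μ a T) ^ 2) -
        Real.log (1 - 2 * rr μ * cosCoord 0 y + rr μ ^ 2)) := by
  have hν : 1 < nuAt μ a T := lt_of_lt_of_le hμ (le_nuAt (by linarith) ha hT)
  rw [ysc, yzero, log_Dfun hν, log_Dfun hμ]; ring

/-- `Ŷ(n+1)`. [folklore] -/
private theorem yhat_succ (μ a T : ℝ) (n : ℕ) :
    yhat μ a T ((n : ℤ) + 1) = (rr (nuAt μ a T) ^ (n + 1) - rr μ ^ (n + 1)) / (2 * a * ((n : ℝ) + 1)) := by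
  have h1 : ((n : ℤ) + 1) ≠ 0 := by omega
  have h2 : ((n : ℤ) + 1).natAbs = n + 1 := by
    rw [show ((n : ℤ) + 1) = ((n + 1 : ℕ) : ℤ) by push_cast; ring]; exact Int.natAbs_natCast _
  rw [yhat, if_neg h1, h2]; push_cast; ring

/-- `Ŷ(-(n+1))`. [folklore] -/
private theorem yhat_neg_succ (μ a T : ℝ) (n : ℕ) :
    yhat μ a T (-((n : ℤ) + 1)) = (rr (nuAt μ a T) ^ (n + 1) - rr μ ^ (n + 1)) / (2 * a * ((n : ℝ) + 1)) := by
  have h1 : (-((n : ℤ) + 1)) ≠ 0 := by omega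
  have h2 : (-((n : ℤ) + 1)).natAbs = n + 1 := by
    rw [Int.natAbs_neg, show ((n : ℤ) + 1) = ((n + 1 : ℕ) : ℤ) by push_cast; ring]; exact Int.natAbs_natCast _
  rw [yhat, if_neg h1, h2]; push_cast; ring

/-- `Ŷ(0) = y₀`. [folklore] -/
@[simp] private theorem yhat_zero (μ a T : ℝ) : yhat μ a T 0 = yzero μ a T := by rw [yhat, if_pos rfl]

/-- `Ŷ(m) ≥ 0` for `m ≠ 0` (`1 < μ`, `a > 0`, `T ≥ 0`). [folklore] -/
private theorem yhat_nonneg (hμ : 1 < μ) (ha : 0 < a) (hT : 0 ≤ T) {m : ℤ} (hm : m ≠ 0) : 0 ≤ yhat μ a T m := by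
  rw [yhat, if_neg hm]
  have h01 := rr_le_rr hμ (le_nuAt (by linarith) ha.le hT)
  exact div_nonneg (sub_nonneg.2 (pow_le_pow_left₀ (rr_pos hμ).le h01 _)) (by positivity)

/-- `|Ŷ(m)| ≤ max(|y₀|, 1/(2a)) · r_{ν(T)}^{|m|}`. [folklore] -/
private theorem abs_yhat_le (hμ : 1 < μ) (ha : 0 < a) (hT : 0 ≤ T) (m : ℤ) :
    |yhat μ a T m| ≤ max |yzero μ a T| (1 / (2 * a)) * rr (nuAt μ a T) ^ m.natAbs := by
  have hν : 1 < nuAt μ a T := lt_of_lt_of_le hμ (le_nuAt (by linarith) ha.le hT)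
  have hr₁ := rr_pos hν
  have h01 := rr_le_rr hμ (le_nuAt (by linarith) ha.le hT)
  have hr₀ := rr_pos hμ
  rcases eq_or_ne m 0 with rfl | hm
  · rw [yhat_zero, Int.natAbs_zero, pow_zero, mul_one]; exact le_max_left _ _
  · rw [abs_of_nonneg (yhat_nonneg hμ ha hT hm), yhat, if_neg hm]
    obtain ⟨p, hp⟩ : ∃ p : ℕ, m.natAbs = p + 1 := ⟨m.natAbs - 1, by have := Int.natAbs_pos.2 hm; omega⟩
    rw [hp]
    have hnum : rr (nuAt μ a T) ^ (p + 1) - rr μ ^ (p + 1) ≤ rr (nuAt μ a T) ^ (p + 1) := by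
      linarith [pow_nonneg hr₀.le (p + 1)]
    have hden : 2 * a ≤ 2 * a * ((p + 1 : ℕ) : ℝ) := by
      have : (1 : ℝ) ≤ ((p + 1 : ℕ) : ℝ) := by exact_mod_cast Nat.succ_le_succ (Nat.zero_le p)
      nlinarith
    calc (rr (nuAt μ a T) ^ (p + 1) - rr μ ^ (p + 1)) / (2 * a * ((p + 1 : ℕ) : ℝ))
        ≤ rr (nuAt μ a T) ^ (p + 1) / (2 * a) := div_le_div₀ (by positivity) hnum (by positivity) hden
      _ = 1 / (2 * a) * rr (nuAt μ a T) ^ (p + 1) := by ring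
      _ ≤ max |yzero μ a T| (1 / (2 * a)) * rr (nuAt μ a T) ^ (p + 1) :=
          mul_le_mul_of_nonneg_right (le_max_right _ _) (by positivity)

/-- The coefficient family of `Y(T)` decays rapidly. [folklore] -/
private theorem rapidDecay_ycoef (hμ : 1 < μ) (ha : 0 < a) (hT : 0 ≤ T) : RapidDecay (ycoef μ a T) := by
  have hν : 1 < nuAt μ a T := lt_of_lt_of_le hμ (le_nuAt (by linarith) ha.le hT)
  exact rapidDecay_of_le_geometric (rr_pos hν).le (rr_lt_one hν) fun k => by
    rw [ycoef, Complex.norm_real, Real.norm_eq_abs]; exact abs_yhat_le hμ ha hT (k 0)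

set_option maxHeartbeats 400000 in
/-- **The Fourier series of `Y(T)`** (scalar form over `ℤ`). [folklore] -/
private theorem hasSum_ysc_int (hμ : 1 < μ) (ha : 0 < a) (hT : 0 ≤ T) (y : UnitAddTorus (Fin 1)) :
    HasSum (fun m : ℤ => (fourier m (y 0) : ℂ) * ((yhat μ a T m : ℝ) : ℂ)) (((ysc μ a T y : ℝ)) : ℂ) := by
  set ν := nuAt μ a T with hν_def
  have hν : 1 < ν := lt_of_lt_of_le hμ (le_nuAt (by linarith) ha.le hT)
  set z : ℂ := (fourier 1 (y 0) : ℂ) with hz_def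
  set F : ℤ → ℂ := fun m => (fourier m (y 0) : ℂ) * ((yhat μ a T m : ℝ) : ℂ) with hF
  have hz : ‖z‖ = 1 := norm_fourier_one y
  have hzc : ‖conj z‖ = 1 := by rw [Complex.norm_conj]; exact hz
  have hr₁ := abs_rr_lt_one hν
  have hr₀ := abs_rr_lt_one hμ
  have ha2 : (2 * (a : ℂ)) ≠ 0 := by
    have : (a : ℂ) ≠ 0 := by exact_mod_cast ha.ne'
    exact mul_ne_zero two_ne_zero this
  have hP : HasSum (fun n : ℕ => F ((n : ℤ) + 1))
      ((1 / (2 * a) : ℂ) * (-Complex.log (1 - rr ν * z) - -Complex.log (1 - rr μ * z))) := by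
    refine hasSum_of_hasSum_eq (((hasSum_pow_div_succ hr₁ hz).sub (hasSum_pow_div_succ hr₀ hz)).mul_left
      (1 / (2 * a) : ℂ)) (fun n => ?_) rfl
    rw [hF]; simp only
    rw [yhat_succ, show ((n : ℤ) + 1) = ((n + 1 : ℕ) : ℤ) by push_cast; ring, fourier_natCast, ← hz_def,
      ← hν_def]
    have hn : ((n : ℂ) + 1) ≠ 0 := by exact_mod_cast Nat.succ_ne_zero n
    push_cast
    field_simp
    ring
  have hN : HasSum (fun n : ℕ => F (-((n : ℤ) + 1)))
      ((1 / (2 * a) : ℂ) * (-Complex.log (1 - rr ν * conj z) - -Complex.log (1 - rr μ * conj z))) := by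
    refine hasSum_of_hasSum_eq (((hasSum_pow_div_succ hr₁ hzc).sub (hasSum_pow_div_succ hr₀ hzc)).mul_left
      (1 / (2 * a) : ℂ)) (fun n => ?_) rfl
    rw [hF]; simp only
    rw [yhat_neg_succ, show ((n : ℤ) + 1) = ((n + 1 : ℕ) : ℤ) by push_cast; ring, fourier_neg_natCast,
      ← hz_def, ← hν_def]
    have hn : ((n : ℂ) + 1) ≠ 0 := by exact_mod_cast Nat.succ_ne_zero n
    push_cast
    field_simp
    ring
  have h := HasSum.of_add_one_of_neg_add_one (f := F) hP hN
  refine hasSum_of_hasSum_eq h (fun m => rfl) ?_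
  have hF0 : F 0 = ((yzero μ a T : ℝ) : ℂ) := by
    rw [hF]; simp only
    rw [fourier_zero, yhat_zero, one_mul]
  have hL1 := log_add_log_conj hr₁ hz
  have hL0 := log_add_log_conj hr₀ hz
  rw [hF0]
  calc (1 / (2 * a) : ℂ) * (-Complex.log (1 - rr ν * z) - -Complex.log (1 - rr μ * z)) + ((yzero μ a T : ℝ) : ℂ) +
        (1 / (2 * a) : ℂ) * (-Complex.log (1 - rr ν * conj z) - -Complex.log (1 - rr μ * conj z))
      = ((yzero μ a T : ℝ) : ℂ) - (1 / (2 * a) : ℂ) *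
          ((Complex.log (1 - rr ν * z) + Complex.log (1 - rr ν * conj z)) -
            (Complex.log (1 - rr μ * z) + Complex.log (1 - rr μ * conj z))) := by ring
    _ = ((yzero μ a T - 1 / (2 * a) * (Real.log (1 - 2 * rr ν * z.re + rr ν ^ 2) -
          Real.log (1 - 2 * rr μ * z.re + rr μ ^ 2)) : ℝ) : ℂ) := by
        rw [hL1, hL0]; push_cast; ring
    _ = ((ysc μ a T y : ℝ) : ℂ) := by rw [ysc_eq hμ ha.le hT, ← hν_def, cosCoord, hz_def]

/-- **The Fourier series of `Y(T)`** as a synthesis on `T¹`. [folklore] -/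
private theorem hasSum_ysc (hμ : 1 < μ) (ha : 0 < a) (hT : 0 ≤ T) (y : UnitAddTorus (Fin 1)) :
    HasSum (fun k : Fin 1 → ℤ => mFourier k y • ycoef μ a T k) (cplx (ysc μ a T) y) := by
  refine hasSum_of_int (hasSum_of_hasSum_eq (hasSum_ysc_int hμ ha hT y) (fun m => ?_) rfl)
  rw [mFourier_fin_one, zEquiv_apply, ycoef, zEquiv_apply, smul_eq_mul]

/-- `𝓕(Y(T))(k) = Ŷ(k₀)`. [folklore] -/
private theorem mFourierCoeff_ysc (hμ : 1 < μ) (ha : 0 < a) (hT : 0 ≤ T) (k : Fin 1 → ℤ) :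
    mFourierCoeff (cplx (ysc μ a T)) k = ycoef μ a T k := by
  have e : fourierSynth (ycoef μ a T) = cplx (ysc μ a T) := funext fun y => (hasSum_ysc hμ ha hT y).tsum_eq
  rw [← e]; exact (rapidDecay_ycoef hμ ha hT).mFourierCoeff_fourierSynth k

end Solution

/-! ## §K The lower bound on `∂¹²⁸ Y(T)(0)` and the contradiction -/

section LowerBound

variable {μ a T : ℝ}

/-- `i¹²⁸ = 1`. [folklore] -/
private theorem I_pow_128 : Complex.I ^ 128 = 1 := by
  rw [show (128 : ℕ) = 4 * 32 from rfl, pow_mul, Complex.I_pow_four, one_pow]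

/-- **The pointwise Fourier expansion of `∂¹²⁸ Y(T)` at the origin** (real form):
`∂¹²⁸Y(T)(0) = ∑_k (2πk₀)¹²⁸ Ŷ(k₀)`. [folklore] -/
private theorem hasSum_iterPartialDeriv_ysc (hμ : 1 < μ) (ha : 0 < a) (hT : 0 ≤ T) :
    HasSum (fun k : Fin 1 → ℤ => (2 * Real.pi * ((k 0 : ℤ) : ℝ)) ^ 128 * yhat μ a T (k 0))
      (iterPartialDeriv (List.replicate 128 0) (ysc μ a T) 0) := by
  have hφ : IsSmooth (ysc μ a T) := isSmooth_ysc (by linarith) a T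
  have h := hasSum_iterPartialDeriv_replicate (isSmooth_cplx hφ) 0 128 (0 : UnitAddTorus (Fin 1))
  rw [iterPartialDeriv_cplx hφ] at h
  have h' := Complex.hasSum_re h
  rw [Complex.ofReal_re] at h'
  refine hasSum_of_hasSum_eq h' (fun k => ?_) rfl
  simp only [mFourier_at_zero, mFourierCoeff_ysc hμ ha hT, ycoef, smul_eq_mul]
  have e : (2 * (Real.pi : ℂ) * Complex.I * ((k 0 : ℤ) : ℂ)) ^ 128 =
      (((2 * Real.pi * ((k 0 : ℤ) : ℝ)) ^ 128 : ℝ) : ℂ) := by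
    rw [show (2 * (Real.pi : ℂ) * Complex.I * ((k 0 : ℤ) : ℂ)) = (2 * (Real.pi : ℂ) * ((k 0 : ℤ) : ℂ)) * Complex.I by ring,
      mul_pow, I_pow_128, mul_one]
    push_cast; ring
  rw [e, ← Complex.ofReal_mul, one_mul, Complex.ofReal_re]

/-- **The lower bound**: `((2π)¹²⁸/(2a)) · 127! · (r₁¹²⁸/(1-r₁)¹²⁸ - r₀¹²⁸/(1-r₀)¹²⁸) ≤ ∂¹²⁸Y(T)(0)`,
`r₁ = r_{ν(T)}`, `r₀ = r_μ`. [folklore] -/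
private theorem lower_bound (hμ : 1 < μ) (ha : 0 < a) (hT : 0 ≤ T) :
    (2 * Real.pi) ^ 128 / (2 * a) * ((Nat.factorial 127 : ℝ) *
      (rr (nuAt μ a T) ^ 128 / (1 - rr (nuAt μ a T)) ^ 128 - rr μ ^ 128 / (1 - rr μ) ^ 128)) ≤
      iterPartialDeriv (List.replicate 128 0) (ysc μ a T) 0 := by
  set r₁ := rr (nuAt μ a T) with hr₁_def
  set r₀ := rr μ with hr₀_def
  have hν : 1 < nuAt μ a T := lt_of_lt_of_le hμ (le_nuAt (by linarith) ha.le hT)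
  have h0 : 0 ≤ r₀ := (rr_pos hμ).le
  have h01 : r₀ ≤ r₁ := rr_le_rr hμ (le_nuAt (by linarith) ha.le hT)
  have h1 : r₁ < 1 := rr_lt_one hν
  have hS := hasSum_iterPartialDeriv_ysc hμ ha hT
  -- the `ℕ`-part of the series
  set c : ℝ := (2 * Real.pi) ^ 128 / (2 * a) with hc
  have hcpos : 0 ≤ c := by positivity
  have hsub := summable_succ_pow_mul_pow_sub 127 h0 h01 h1
  have hplus : HasSum (fun n : ℕ => c * ((((n + 1 : ℕ) : ℝ)) ^ 127 * (r₁ ^ (n + 1) - r₀ ^ (n + 1))))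
      (c * ∑' n : ℕ, (((n + 1 : ℕ) : ℝ)) ^ 127 * (r₁ ^ (n + 1) - r₀ ^ (n + 1))) := hsub.hasSum.mul_left c
  -- comparison with the full series through the injection `n ↦ (n+1)`
  have hle : c * ∑' n : ℕ, (((n + 1 : ℕ) : ℝ)) ^ 127 * (r₁ ^ (n + 1) - r₀ ^ (n + 1)) ≤
      iterPartialDeriv (List.replicate 128 0) (ysc μ a T) 0 := by
    refine hasSum_le_inj (fun n : ℕ => zEquiv ((n : ℤ) + 1)) (fun m n hmn => ?_) (fun k _ => ?_) (fun n => ?_)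
      hplus hS
    · have := congrFun hmn 0
      simp only [zEquiv_apply] at this
      have h2 := add_right_cancel this
      exact_mod_cast h2
    · -- all terms of the full series are nonnegative
      rcases eq_or_ne (k 0) 0 with hk | hk
      · rw [hk]; simp
      · exact mul_nonneg (by positivity) (yhat_nonneg hμ ha hT hk)
    · simp only [zEquiv_apply]
      rw [yhat_succ, hc]
      have hn : ((n : ℝ) + 1) ≠ 0 := by positivity
      push_cast
      field_simp
      ring_nf
      rfl
  refine le_trans ?_ hle
  exact mul_le_mul_of_nonneg_left (factorial_mul_sub_le_tsum 127 h0 h01 h1) hcpos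

end LowerBound

/-! ## §L The refutation -/

section Main

/-- A numerical inequality: `128 · 10005¹²⁸ + 9999¹²⁸ < 10624¹²⁸`. [folklore] -/
private theorem numeric_key : (128 : ℝ) * 10005 ^ 128 + 9999 ^ 128 < 10624 ^ 128 := by norm_num

/-- `1 + 1/16 ≤ e^{1/16}`. [folklore] -/
private theorem exp_sixteenth : (1 : ℝ) + 1 / 16 ≤ Real.exp (1 / 16) := by
  have := Real.add_one_le_exp (1 / 16 : ℝ); linarith

set_option maxHeartbeats 400000 in
/-- **Refutation of Armstrong–Vicol App. A Lemma 7.7 AS PRINTED** (the vendored fact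
`Torus.ArmstrongVicol2025_transportShift`, radius `R_Y(t) = R_g + 4|t| d C_f R_f²`): in dimension `d = 1`
take `f = -(a/2π) sin θ` with `a = π`, `C_f = 1`, `R_f = 4π` (so `T = 1/(4dC_fR_f) = 1/(16π)`, `aT = 1/16`),
`g = g_μ = (1 + cos θ)/((1+μ²) + (1-μ²) cos θ)` with `μ = 10⁴`, `R_g = π(μ+1)`, `C_g = (N+1)²`, `N = 128`;
the transported solution is `Y(t) = t - (1/2a) log(D_{μe^{at}}/D_μ)`, whose `128`-th derivative at the origin
at time `T` is `≥ (π¹²⁷/2)·127!·((μe^{1/16} - 1)¹²⁸ - (μ-1)¹²⁸)`, while the asserted bound gives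
`≤ (π¹²⁷/2)·128!·(μ+5)¹²⁸`; but `10624¹²⁸ - 9999¹²⁸ > 128 · 10005¹²⁸`. The corrected statement (radius
`R_g(1 + 4|t| d C_f R_f)`) is the theorem `Torus.dnorm_transportShift_le`.
[cite: ArmstrongVicol2025, App. A Lemma 7.7 (arXiv §7.2 p. 72, (e.bear.salmon.1)–(e.bear.salmon.2))] -/
theorem not_ArmstrongVicol2025_transportShift : ¬ ArmstrongVicol2025_transportShift (Fin 1) := by
  intro hAV
  set μ : ℝ := 10000 with hμ_def
  set T : ℝ := 1 / (16 * Real.pi) with hT_def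
  have hπ := Real.pi_pos
  have hμ1 : (1 : ℝ) < μ := by norm_num [hμ_def]
  have hμ0 : (0 : ℝ) < μ := by linarith
  have hT0 : 0 ≤ T := by positivity
  have hcard : (Fintype.card (Fin 1) : ℝ) = 1 := by simp
  -- hypotheses on the drift and the source
  have hf : ∀ n, 1 ≤ n → n ≤ 128 → ∀ t : ℝ, dnorm n (4 * Real.pi) (fvec Real.pi t) ≤ 1 :=
    fun n _ _ t => dnorm_fvec_le n t
  have hg : ∀ n, 1 ≤ n → n ≤ 128 → ∀ t : ℝ, dnorm n (Real.pi * (μ + 1)) (gvec μ t) ≤ (((128 : ℕ) : ℝ) + 1) ^ 2 := by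
    intro n hn hN t
    refine (dnorm_gvec_le hμ1 hn t).trans ?_
    have : (n : ℝ) ≤ ((128 : ℕ) : ℝ) := by exact_mod_cast hN
    gcongr
  have hTle : |T| ≤ 1 / (4 * (Fintype.card (Fin 1) : ℝ) * 1 * (4 * Real.pi)) := by
    rw [hcard, abs_of_nonneg hT0, hT_def]
    apply le_of_eq; ring
  have hμ4 : 4 * Real.pi ≤ Real.pi * (μ + 1) := by rw [hμ_def]; nlinarith [Real.pi_pos]
  have hconc := hAV 128 (fvec Real.pi) (gvec μ) (Yvec μ Real.pi) 1 (4 * Real.pi) ((((128 : ℕ) : ℝ) + 1) ^ 2)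
    (Real.pi * (μ + 1)) one_pos (by positivity) (by positivity) (by positivity) hμ4
    (isSmoothSpaceTimeOn_fvec _) (isSmoothSpaceTimeOn_gvec hμ0.ne') (isSmoothSpaceTimeOn_Yvec hμ0 _)
    (Yvec_zero μ Real.pi) (hasDerivAt_Yvec hμ0 hπ.ne') hf hg 128 (by norm_num) le_rfl T hTle 0
  -- read the conclusion on the scalar solution
  rw [hcard, abs_of_nonneg hT0] at hconc
  have hYsc : (fun y => Yvec μ Real.pi T y 0) = ysc μ Real.pi T := by
    funext y; simp [Yvec]
  rw [hYsc] at hconc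
  set RY : ℝ := Real.pi * (μ + 1) + 4 * T * 1 * 1 * (4 * Real.pi) ^ 2 with hRY_def
  have hRY : RY = Real.pi * 10005 := by
    rw [hRY_def, hT_def, hμ_def]; field_simp; ring
  have hRYpos : 0 < RY := by rw [hRY]; positivity
  -- upper bound on the 128-th derivative at the origin
  have hupper := norm_iterPartialDeriv_le_of_dnorm_le (isSmooth_ysc hμ0 Real.pi T) hRYpos hconc
    (l := List.replicate 128 0) (by simp) 0
  have hupper' : iterPartialDeriv (List.replicate 128 0) (ysc μ Real.pi T) 0 ≤
      ((Nat.factorial 128 : ℝ)) * Real.pi ^ 127 * 10005 ^ 128 / 2 := by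
    refine ((Real.le_norm_self _).trans hupper).trans (le_of_eq ?_)
    rw [hRY, hT_def, mul_pow]
    generalize ((Nat.factorial 128 : ℕ) : ℝ) = F
    generalize ((10005 : ℝ)) ^ 128 = B
    field_simp
    ring
  -- lower bound
  have hlower := lower_bound (a := Real.pi) (T := T) hμ1 hπ hT0
  have hν : 1 < nuAt μ Real.pi T := lt_of_lt_of_le hμ1 (le_nuAt hμ0 hπ.le hT0)
  have e1 : rr (nuAt μ Real.pi T) ^ 128 / (1 - rr (nuAt μ Real.pi T)) ^ 128 = ((nuAt μ Real.pi T - 1) / 2) ^ 128 := by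
    rw [← div_pow, rr_div_one_sub_rr hν]
  have e0 : rr μ ^ 128 / (1 - rr μ) ^ 128 = ((μ - 1) / 2) ^ 128 := by
    rw [← div_pow, rr_div_one_sub_rr hμ1]
  rw [e1, e0] at hlower
  set X : ℝ := nuAt μ Real.pi T - 1 with hX
  have hX' : (10624 : ℝ) ≤ X := by
    rw [hX, nuAt, hμ_def, hT_def]
    have h := exp_sixteenth
    rw [show Real.pi * (1 / (16 * Real.pi)) = 1 / 16 by field_simp]
    linarith
  have hlower' : (Nat.factorial 127 : ℝ) * Real.pi ^ 127 * (X ^ 128 - 9999 ^ 128) / 2 ≤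
      iterPartialDeriv (List.replicate 128 0) (ysc μ Real.pi T) 0 := by
    refine le_trans (le_of_eq ?_) hlower
    rw [hμ_def, show ((10000 : ℝ) - 1) = 9999 by norm_num, div_pow, div_pow, mul_pow]
    generalize ((Nat.factorial 127 : ℕ) : ℝ) = F
    generalize ((9999 : ℝ)) ^ 128 = C
    generalize X ^ 128 = XP
    field_simp
  -- combine (all large numerals abstracted into atoms)
  have hfac : ((Nat.factorial 128 : ℕ) : ℝ) = 128 * (Nat.factorial 127 : ℝ) := by
    rw [show (128 : ℕ) = 127 + 1 from rfl, Nat.factorial_succ]; push_cast; ring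
  have h127 : (0 : ℝ) < (Nat.factorial 127 : ℝ) := by exact_mod_cast Nat.factorial_pos 127
  have hπ127 : (0 : ℝ) < Real.pi ^ 127 := by positivity
  have hK : (0 : ℝ) < (Nat.factorial 127 : ℝ) * Real.pi ^ 127 := mul_pos h127 hπ127
  have hnum := numeric_key
  have hXpow : (10624 : ℝ) ^ 128 ≤ X ^ 128 := pow_le_pow_left₀ (by norm_num) hX' 128
  set B : ℝ := (10005 : ℝ) ^ 128 with hB
  set C : ℝ := (9999 : ℝ) ^ 128 with hC
  set D : ℝ := (10624 : ℝ) ^ 128 with hD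
  set XP : ℝ := X ^ 128 with hXP
  set K : ℝ := (Nat.factorial 127 : ℝ) * Real.pi ^ 127 with hK_def
  have h := hlower'.trans hupper'
  rw [hfac] at h
  have h2 : K * (XP - C) ≤ K * (128 * B) := by
    have e1 : (Nat.factorial 127 : ℝ) * Real.pi ^ 127 * (XP - C) / 2 = K * (XP - C) / 2 := by rw [hK_def]
    have e2 : 128 * (Nat.factorial 127 : ℝ) * Real.pi ^ 127 * B / 2 = K * (128 * B) / 2 := by rw [hK_def]; ring
    rw [e1, e2] at h
    linarith
  have hmain : XP - C ≤ 128 * B := le_of_mul_le_mul_left h2 hK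
  linarith

end Main

end TransportShiftRefutation

end Torus

end Literature.Analysis.FunctionSpaces

end
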